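import Literature.MathematicalPhysics.QuantumFieldTheory.Balaban1983to89.B2Lemma24SupG
import Literature.MathematicalPhysics.QuantumFieldTheory.Balaban1983to89.B2Prop22RegularRegionPair

/-!
# [B2] Lemma 2.4, proof p. 572 «Using Proposition 2.2 and the restrictions (2.55) we get (2.67)»: THE FOUR (2.58) KERNEL
# INPUTS `kerΩ_far`, `kerΩ_near`, `dkerΩ_far`, `dkerΩ_near` of the Lemma 2.4 family of record (`B2Lemma24Proof.Model` →
# `B2Lemma24RemD.ModelR` → `B2Lemma24SupG.ModelS`/`ModelT`) DISCHARGED from the tree's Proposition 2.2 at a regular field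
# (`B2Prop22RegularRegionPair.ineq258_regionPairFam` = r01's [B4] Theorem p. 573 on region pairs through p17's bridge), by
# identifying the box lineage's `□ = B^k(□₂)` with r01's fine region over the unit labels `□₂ + o ⊂ Λ₂^{(k−1)′}`

statement-level skeleton of published theorems with citation tags; proofs where landed; nothing here is a claim about
the Yang–Mills mass gap

**Sources.** T. Bałaban, *(Higgs)₂,₃ quantum fields in a finite volume. II. An upper bound*, Commun. Math. Phys. **86**
(1982) 555–594 (bib key `Balaban1982Higgs2`, «B2»; held `paper:balaban1982-cmp86-higgs23-ii`, journal page = PDF page +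
554; text layer `p0016.txt`–`p0020.txt` = pp. 570–574 re-read this session, renders
`run/shared/lean/pub/pub-balaban/b2b-balaban-ref1/pages/1982-cmp86-higgs23-II/1982-cmp86-higgs23-II-p017-x2.png`,
`-p018-x2.png`): (2.56) p. 570, Proposition 2.2 (2.58) pp. 570–571, the sentence after (2.60) p. 571, Lemma 2.4
(2.65)–(2.66) and (2.67) p. 572; T. Bałaban, *Regularity and decay of lattice Green's functions*, Commun. Math. Phys.
**89** (1983) 571–597 (bib key `Balaban1983RegularityDecay`, «B4»): (1.1)–(1.6) p. 572, Theorem p. 573, §2 p. 575 («Ω is a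
sum of the corresponding large blocks»).  A NEW LEAF over `B2Lemma24SupG` (lit-balaban p23 g18, p337576/p338198/p338819:
`FrameS`, `ModelS`, `ModelT`, `famOfT`, `κS`, `embS`, `ΓS`, `AprS`, `A0S`, `thetaS`, `constBond_add_AprS`; over r04 g18's
`B2Lemma24RemD` p336252: `ModelR.toModel`, `toModel_restr`, `toModel_dev`; over p23 g5's `B2Lemma24Proof` p250408:
`kerBox`, `dkerBox`, `dKer`, `lemma24_bounds`) and `B2Prop22RegularRegionPair` (p23 g14, p322848: `avgQ`, `single`, `srcQ`,
`lsrc`, `ldist`, `lbase`, `extR_lsrc`, `fld_mul_avgQ_transpose_mulVec_single`, `ineq258_regionPairFam`); used BY NAME,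
nothing restated: r01 g8 `B4ThmRegionPairEta.{RegionPairInst, regionPairFam, Kmod, RegionPairInst.(GΩ, G₀, DΩ, deltaV,
cdist, cdist_nonneg, fld_deltaV_apply, fld_DΩ_deltaV_apply)}` (p314051), r01 g9 `B4ThmTorusPairEta.lat_le_cdist` (p318600),
r01 g7 `B4RegionCubeCarrier.{boxEmb, boxEmbY, boxEmb_injective, boxEmbY_injective, inBox_iff, blk_boxEmb, regWt_boxEmb,
rBlkWt_boxEmb, contourTrans_boxEmb, rBlkWt_boxEmb_ne_zero, compField_add, fineDom_mono}`, p17 g4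
`B4CubeOpReindex.{cutWt, covOp_cut_submatrix}`, b05 `B4Sect5Proof.{latticeConst, latticeSum_le}`, b04
`B4GaugeCovariance.{b4Op, blockOp_apply, fld, fieldLink, contourTrans, avgOp}`, `B4Lemma21Region.{regionOp, regionDeriv,
fld_covDeriv_mulVec_of_mem, fld_covDeriv_mulVec_of_not_mem}`, `B4Lemma22ReduceZero.{Box, opA, greenA, derivA}`,
`B2Eq268GaugeAway.{avgA, blkSite}`, Mathlib's `Matrix.inv_submatrix_equiv` / `Matrix.submatrix_mul_equiv`.  No existing
module is touched, no definition of record altered, nothing of [B2]/[B4] asserted as a fact.  Unit `lit-balaban-p23`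
gen 19 (Phase-2 proof seat p23, owner of `B2Lemma24Proof`), 2026-08-22; SKELETON row **B2.Lem2.4** (fold owner r02, second
reader r14, referee ref-4; decl of record `B2.Lemma24Printed`; head by the fold owner's criterion — asked before filing,
`lit-balaban-r02/INBOX.md` 19:43Z); successor item (ii) of HOME/HANDOFF.md § lit-balaban-p23 gen 18.  v1.0 = p340291;
v1.1 (this text) is DOCSTRING-ONLY — declarations byte-identical —: the K4′/K5-P2 sentences of the fold owner's criterion
(`lit-balaban-r02/B2-CLOSURE.md` §32a) in HONEST SCOPE (c)/(d) and the head docstring, and two quotation subscripts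
corrected against the ×2 renders ((2.56) «…Λ₆^{(k−1)′}φ», p. 572 «□ ⊂ B^k(Λ₂^{(k−1)′})»); v1.2 is
DOCSTRING-ONLY: the locator of [B4] (1.7) corrected to p. 572 (×4; r04's CITELOC audit g22); v1.3 (this text, p23 gen 20) is
DOCSTRING-ONLY: the (2.58) restriction locator split «Prop. 2.2 (2.58) p. 570; p. 571 «for b ⊂ Ω, dist(b, Ω^c) ≧ R₀»» (×4;
(2.58) is the last display of p. 570, its restriction clause the first line of p. 571) and the (2.39) locator split p. 582 /
clause p. 583 (summit-lit1 CITELOC #21 P84-005/P84-006).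

## WHAT IS PRINTED (verbatim «…»)

[B2] p. 570 (2.56) [PDF 16]: «φ^{(k)} = a_kG_k(B^k(Λ₂^{(k−1)′}), A^{(k)})Q_k^*(A^{(k)})Λ₆^{(k−1)′}φ.»  Proposition 2.2,
pp. 570–571: «Let Ω and A satisfy the assumptions of Proposition I.2.1, then for e(L^kε) sufficiently small there exist
positive constants δ₀, c₀, R₀ independent of A, k, Ω and depending on d, a, M, such that
|(D^η_AG_k(Ω, A)Q_k^*(A))(b, y)| ≦ c₀ exp(−δ₀ dist(b, y)), (2.58) for b ⊂ Ω, dist(b, Ω^c) ≧ R₀, y ∈ Ω^{(k)}. The identical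
inequality holds for G_k(Ω, A)Q_k^*(A), and for D^η_AδG_k(Ω, Ω₀, A)Q_k^*(A), δG_k(Ω, Ω₀, A)Q_k^*(A) with the additional
factor exp(−δ₀(dist(b, Ω^c) + dist(y, Ω^c))).»  p. 571, after the proof of Lemma 2.3: «The inequality (2.60) implies that
the configuration A^{(k)} considered on the set B^k(Λ₂^{(k−1)′}) satisfies the assumption of Proposition I.2.1. on a vector
field configuration.»  p. 572 [PDF 18]: «Let us define □₁, □₂ as the sums of large blocks contained in Λ₇^{(k−1)′} and
distant from the point y less than 2r(L^kε), 4r(L^kε) respectively, and let us denote □ = B^k(□₂). Of course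
□ ⊂ B^k(Λ₂^{(k−1)′}). Using Proposition 2.2 and the restrictions (2.55) we get
φ^{(k)}(x) = (a_kG_k(□, A^{(k)})Q_k^*(A^{(k)})□₁φ)(x) + O((L^kε)^κ), x ∈ B^k(y), (2.67) and the same equality for the
covariant derivative of φ^{(k)}.»  [B4] p. 575: «We have assumed that Ω^{(k)} is a sum of large blocks, i.e. blocks of the
size M on the unit lattice, thus Ω is a sum of the corresponding large blocks of the size M on η-lattice T_η.»

## DICTIONARY (how the four fields read the print, and what replaces them)

In `B2Lemma24Proof.Model` (and verbatim in `ModelR`/`ModelS`/`ModelT`) the outer field of (2.56) is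
`φ^{(k)}(x) = Σ_{y′ ∈ Tout} K_Ω(x, y′)φ(y′)` with ABSTRACT kernel rows `KΩ : □ → Yo → Matrix ι ι ℝ` at `x ∈ B^k(y)`,
distances `dΩ`, and the printed inputs of (2.67) as HYPOTHESIS FIELDS: `kerΩ_far` (`|K_Ω(x,y′)v| ≤ cO e^{−δO dΩ(x,y′)}|v|`,
the plain clause of (2.58) for `G_k(Ω,A^{(k)})Q_k^*(A^{(k)})`), `kerΩ_near` (`|(K_Ω(x,y′) − K_□(x,y′))v| ≤
cO e^{−δO R₄}e^{−δO dΩ}|v|` for `y′ ∈ □₂`, the `δG_k(□, Ω, A^{(k)})Q_k^*` clause with `dist(x, □^c) ≥ R₄`, `K_□ = kerBox` =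
the blocks of the box lineage's `a_k·greenA·avgAᵀ`), and their bond-derivative twins `dkerΩ_far`, `dkerΩ_near` (`dKer`,
`dkerBox`); plus the lattice sum `summableΩ`.  HERE: `Ω = B^k(Λ₂^{(k−1)′})` is r01's fine region `fineDom L^k Ω₀c` over the
unit labels `Ω₀c` of `Λ₂′` (a finite union of big blocks of `ηℤ^{d+1}`), the box `□₂` sits at the corner `o` of the unit
lattice (`□₂ + o ⊂ Ω₀c`), `A^{(k)}` is a component field `Ac` on `ηℤ^{d+1}`, (2.23)/(1.7)-regular on `Ω` (the p. 571
sentence), the box field of `ModelT` is its translate `Ac(· + L^ko)` (`shiftF`); `K_Ω(x, y′) :=` the `(x + L^ko, y′)` block of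
`a_k·G_k(Ω,A)·Q_k(A)ᵀ` for r01's `G_k(Ω,A) = RegionPairInst.G₀` and the carrier's own `Q_k(A)` (`avgQ`, p23 g14:
`b4Op_eq_avgQ`); `dΩ(x, y′) := |y(x) + o − y′|_∞` (label sup-distance); `Yo := ↥Ω₀c`, `inc := y′ ↦ y′ + o`.  The identities
that make the model's `K_□` the SAME object as r01's `G_k(□₂+o, A)Q_k^*(A)`: r01's operator (1.6) over the labels `□₂ + o`,
reindexed along `x ↦ x + L^ko` (a bijection `□ ≃ fineDom L^k(□₂+o)`), IS the box lineage's `opA` with the corner embedding,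
staircase contours and the translated field (`regionOp_submatrix_eB`: bond weights, block weights, links and transporters
restrict — r01's `B4RegionCubeCarrier` identities —, no bond is cut), hence so are the inverses (`green_submatrix_eB`) and
the averaging operators (`avgQ_submatrix_eB`), kernel block by kernel block (`kerBox_mulVec_eq`, `dkerBox_mulVec_eq`).

## WHAT THIS FILE CERTIFIES (kernel-checked, zero `sorry`; standard axioms)

* §1 `boxLabels M o` (`= o + [0,M)`), the bijections `eB : □ → fineDom L^k(□₂+o)` (`x ↦ x + L^ko`), `eY : □₂ → □₂+o`
  (r01's `boxEmb`/`boxEmbY`), surjectivity, the equivalences `eBquiv`, `eYquiv`, `eBι`, `eYι`.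
* §2 TRANSPORT: `regionOp_submatrix_eB` (**`H_k(Ω_{□₂+o}, A)|_{eB} = opA(□, A(·+L^ko))`**), `green_submatrix_eB`,
  `avgQ_submatrix_eB`, `greenQ_apply_eB`, `block_mulVec_eq_fld`, **`kerBox_mulVec_eq`** (`K_□(x,y′)v =
  a_k(G_k(Ω_{□₂+o},A)f_{y′+o,v})(x+L^ko)` with p23 g14's source `f_{y,v} = Q_k^*(A)(vδ_y)`), `fld_regionDeriv_boxEmb`,
  **`dkerBox_mulVec_eq`**.
* §3 geometry: `supNorm_label_le` (`L^k(|y(u) − z|_∞ − 1) ≤ |u − L^kz|_∞`), `mem_fineDom_boxLabels_iff`, `deep_supNorm_le`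
  (the model's `deep` clause gives `dist(x, □^c) ≥ R`).
* §4 the constants `dP, cP, rP, eP` (`δ₀, c₀, R₀, e₁`) and modulus `KP = Kmod` of `ineq258_regionPairFam`, chosen once; `P_spec`.
* §5 `FrameU` = `FrameS` + (`δO ≤ δ₀`, `a₊c₀e^{δ₀} ≤ cO`, `K_{d+1}(δO/2) ≤ SO`); `FrameU.ofFrameS`: EVERY `FrameS` upgrades.
* §6 **`ModelU fr`** = the fields of `ModelT` MINUS {`KΩ`, `dΩ`, `dΩ_nonneg`, `summableΩ`, `inc`, `inc_inj`, `φ`, `φΩ_inc`,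
  `kerΩ_far`, `kerΩ_near`, `dkerΩ_far`, `dkerΩ_near`} PLUS {`o`, `Ω₀c`, `hbox` (□₂+o ⊂ Λ₂′), `hbigΩ`/`hbigB` (Ω and □ unions
  of `Kmod`-blocks), `Ac` on `ηℤ^{d+1}` with `hreg` = (2.23) on `Ω`, `hleP` (`e ≤ e₁` of (2.58)), `hRP` (`R₀ ≤ R`), `hR4`
  (`R₄ ≤ R`)}; `instI` (the pair `□ ⊂ Ω`), `instO` (the pair `Ω ⊂ Ω`) in r01's family with `regular`/`bigBlocks` met;
  `KΩ`, `dL`; `KΩ_mulVec`, `KΩ_sub_kerBox_mulVec` (`= −a_k·δG_k(□,Ω,A)f`), `dKer_KΩ_mulVec`, `dKer_sub_dkerBox_mulVec`;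
  `R_le_cdistI/O`, `exp_ldistO/I_le`, `exp_cdist_le`; **`kerΩ_far`, `kerΩ_near`, `dkerΩ_far`, `dkerΩ_near` — THE FOUR
  FIELDS ARE THEOREMS**; **`summableΩ`** (b05's uniform lattice sums).
* §7 `ModelU.toModelT` (the twelve removed fields filled by the definitions and theorems), `famOfU := famOfT ∘ toModelT`
  (outer-site type `↥Ω₀c` per instance), **`lemma24Printed_modelU : B2.Lemma24Printed (famOfU fr)`** — one constant per
  frame, uniform over the outer regions (`lemma24_bounds` is uniform in the outer-site type).

## HONEST SCOPE

(a) CARRIER: `Ω = B^k(Λ₂^{(k−1)′})` is read as a finite union of big blocks of `ηℤ^{d+1}` (r01's `regionPairFam`; `ℓ^∞`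
distances in unit-lattice units; the `R₀` restriction live).  [B2] works on the torus `T_η`: an `Λ₂′` that wraps around
the torus — in particular `Λ₂′ =` the whole unit torus — is NOT a member of this family; the torus twin ((2.58) on r01's
torus pairs is in the tree: `B2Prop22RegularTorusPair`) needs the box ↔ torus-region transport of §2 and is successor work.
(b) SUB-FAMILY as in `B2Lemma24SupG` HONEST SCOPE (a): staircase contours, charge `e/L^k`, component field; the regularity
hypothesis is now (2.23)/(1.7) ON `Ω` (the printed hypothesis, p. 571 sentence) instead of on `□` only.  (c) WHAT REMAINS a
hypothesis field of `ModelU`: NOTHING OF ESTIMATE SHAPE — data; the geometry of (2.67)/(2.78): `hbox`, `hbigΩ`, `hbigB`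
(big-block modulus = r01's `Kmod`, a function of `(d, L, a₋, a₊, m²₊, U, ℓ₁)`, where print has the procedure's `M`), `deep`
with `hRP`/`hR4`/`hR1` (depth of `B^k(y)` in `□` at least `max(R₀, R₄, 1)` unit blocks — print: `□₂` has radius
`4r(L^kε) → ∞`), `far1`, `inc_mem` (`□₁ ⊂ Tout ⊂ Λ₂′`), `farΩ` (sites of (2.56) off `□₁` at label distance `≥ R₂`), `hMS`,
`hM3`; the regularity (2.23) on `Ω` ((2.60), row B2.Lem2.3); smallness of `e(L^kε)` (`hle`, `hleP`, `hθ1`, `hτ1`) — the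
thresholds `eNC1` (r04's `eNC`, a `choose`) and `eP1` (the `e₁` of `ineq258_regionPairFam`, a `choose`) are not
kernel-explicit; that print's `e(L^kε)` meets them for `ε` sufficiently small (Prop. 2.2 p. 570 «for e(L^kε) sufficiently
small») is a located PROSE claim, zero head weight —; the scale
products `kap`, `sepG`, `sepD`, `sepO₂`, `sepO₄`, `θ_scale`, `τ_scale`, `θ'_scale`, `q_le` (the «O((L^kε)^{κ₀})»/«O(p)»
bookkeeping across one scale); (2.55) via `Restr`.  The INTENDED INSTANCE of this geometry is the print's own: `y ∈ Λ₇′`,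
`□₂`/`□₁` = the large blocks of `Λ₇′` within `4r(L^kε)`/`2r(L^kε)` of `y` (p. 572), big blocks of the procedure's size `M`
(`K₀`), `Ω = B^k(Λ₂′)` — for `ε` small these meet `deep`/`hRP`/`hR4`/`farΩ` with `R, R₂ ≍ r(L^kε) → ∞`; parts of that
geometry are kernel objects elsewhere in the lineage (`B2Eq28RegionsBigBlockUnion` p332981: the regions are big-block
unions; the `eq267_*_tower_collar` family of `B2Eq267HiggsRegionAsPrinted` p337001: the 4r/2r cubes and the ∂Λ₇′ collar on
the (Higgs)₂,₃ carrier); deriving (c) from `y ∈ Λ₇′` inside the kernel is NOT done here.  (d) CONSTANTS: the frame constraints `hδP`, `hcP`, `hSP` are choices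
(`ofFrameS`); `C` of the row depends on the frame only — precisely (criterion K4′ of `lit-balaban-r02/B2-CLOSURE.md` §32a):
`C` = the constant of `lemma24_bounds fr.toFrame`, a function of the fields of `fr.toFrame` alone — `d`, `ℓ` (`L = ℓ+1`),
`F`/`ℓ₁`, `a₋, a₊, m²₊`, the frame's (2.58)-type constants `cO, δO` and lattice-sum constant `SO` (tied to the
`dP, cP (d, F, ℓ, a±, m²₊, c_reg, β)` of `ineq258_regionPairFam` and to `latticeConst (d+1) (δO/2)` by `hδP`/`hcP`/`hSP`),
`c_I, r₁, r₂`, `K₁…K₅, Kθ, Kτ, K_D` —; it does NOT depend on the region `Ω₀c` / `|Tout|` (the volume), on `k`, on the cube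
sides `M` nor on their frame bound `S`, on `A`, `φ`, `e`, nor on the base points; `S`, `c_reg`, `β` and the sizes enter only
the thresholds `e₁` (`eNC1`, `eP1`), `hθ1`/`hτ1`/`θ'_scale` and `hRP`/`hR4`/`hR1`, never `C`.  (e) `Model`, `ModelR`, `ModelS`, `ModelT` untouched: `toModelT`
feeds them verbatim.  (f) Kernel-block reading of (2.58) as in p23 g14 (`|·|` of an `N × N` block = operator norm, `y` as
the base corner `L^ky`, the block `y(x)` of `x`); the label distance costs the factor `e^{δ₀}` in `cO`.  Value = the last
estimate-shaped hypothesis fields of the Lemma 2.4 family replaced by PROVED theorems of the tree ((2.58) ×4, the lattice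
sum); NOT summit progress.
-/

namespace Literature.MathematicalPhysics.QuantumFieldTheory.Balaban1983to89.B2Lemma24KerOmega

open Finset Matrix
open Literature.MathematicalPhysics.QuantumFieldTheory.Balaban1983to89.B4GaugeCovariance
open Literature.MathematicalPhysics.QuantumFieldTheory.Balaban1983to89.B4Lower18 (fineDom mem_fineDom IsBlockUnion)
open Literature.MathematicalPhysics.QuantumFieldTheory.Balaban1983to89.B4Lower18Regular (e1 lsum baseEmb stairContour
  base_le_of_blk)
open Literature.MathematicalPhysics.QuantumFieldTheory.Balaban1983to89.B4Lower18RegularRegion (regWt rBlkWt rbaseEmb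
  rstairContour compField)
open Literature.MathematicalPhysics.QuantumFieldTheory.Balaban1983to89.B4Lemma21Region (siteNorm regionOp regionDeriv
  covDeriv fld_covDeriv_mulVec_of_mem)
open Literature.MathematicalPhysics.QuantumFieldTheory.Balaban1983to89.B4Reflection242 (nbrs mem_nbrs boxDom mem_boxDom blk
  blk_mem_boxDom)
open Literature.MathematicalPhysics.QuantumFieldTheory.Balaban1983to89.B4ContourShift (supNorm supNorm_nonneg
  exists_supNorm_eq abs_le_supNorm)
open Literature.MathematicalPhysics.QuantumFieldTheory.Balaban1983to89.B4Lemma22Reduce231 (supN siteNorm_nonneg siteNorm_smul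
  siteNorm_zero)
open Literature.MathematicalPhysics.QuantumFieldTheory.Balaban1983to89.B4Lemma22ReduceZero (Box greenA opA derivA)
open Literature.MathematicalPhysics.QuantumFieldTheory.Balaban1983to89.B4CubeOpReindex (cutWt covOp_cut_submatrix)
open Literature.MathematicalPhysics.QuantumFieldTheory.Balaban1983to89.B4RegionCubeCarrier (boxEmb boxEmbY boxEmb_injective
  boxEmbY_injective blk_boxEmb regWt_boxEmb rBlkWt_boxEmb contourTrans_boxEmb rBlkWt_boxEmb_ne_zero compField_add incl inclY)
open Literature.MathematicalPhysics.QuantumFieldTheory.Balaban1983to89.B4Eq221L2FactorRegion (acBond)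
open Literature.MathematicalPhysics.QuantumFieldTheory.Balaban1983to89.B2Eq268GaugeAway
open Literature.MathematicalPhysics.QuantumFieldTheory.Balaban1983to89.B2Lemma24Proof
open Literature.MathematicalPhysics.QuantumFieldTheory.Balaban1983to89.B2Lemma24RemD
open Literature.MathematicalPhysics.QuantumFieldTheory.Balaban1983to89.B2Lemma24SupG
open Literature.MathematicalPhysics.QuantumFieldTheory.Balaban1983to89.B2Prop22RegularRegionPair (avgQ single srcQ
  fld_mul_avgQ_transpose_mulVec_single srcQ_smul)

noncomputable section

variable {d : ℕ} {ι : Type} [Fintype ι] [DecidableEq ι]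

/-! ## §1 The unit labels of the translated box `□₂ + o` and the bijections onto the fine box -/

section Labels

/-- the unit labels `o + [0, M)` of the box `□₂` placed at the corner `o` of the unit lattice `T_1^{(k)}`.
[cite: Balaban1982Higgs2, p. 572 «□₂ … the sums of large blocks … □ = B^k(□₂)»; Balaban1983RegularityDecay, (1.1) p. 572] -/
def boxLabels (M : Fin (d + 1) → ℕ) (o : Fin (d + 1) → ℤ) : Finset (Fin (d + 1) → ℤ) :=
  Fintype.piFinset fun i => Finset.Ico (o i) (o i + M i)

/-- membership in `□₂ + o`. [cite: Balaban1982Higgs2, p. 572 «□ = B^k(□₂)», dictionary] -/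
theorem mem_boxLabels {M : Fin (d + 1) → ℕ} {o : Fin (d + 1) → ℤ} {y : Fin (d + 1) → ℤ} :
    y ∈ boxLabels M o ↔ ∀ i, o i ≤ y i ∧ y i < o i + M i := by
  simp [boxLabels, Fintype.mem_piFinset]

/-- `y + o ∈ □₂ + o` for `y ∈ □₂`. [cite: Balaban1982Higgs2, p. 572 «□ = B^k(□₂)», dictionary] -/
theorem shift_mem_boxLabels (M : Fin (d + 1) → ℕ) (o : Fin (d + 1) → ℤ) (y : ↥(boxDom M)) :
    y.1 + o ∈ boxLabels M o := by
  rw [mem_boxLabels]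
  intro i
  obtain ⟨h1, h2⟩ := (mem_boxDom.1 y.2) i
  simp only [Pi.add_apply]
  constructor <;> linarith

/-- `y − o ∈ □₂` for `y ∈ □₂ + o`. [cite: Balaban1982Higgs2, p. 572 «□ = B^k(□₂)», dictionary] -/
theorem sub_mem_boxDom {M : Fin (d + 1) → ℕ} {o : Fin (d + 1) → ℤ} {y : Fin (d + 1) → ℤ} (hy : y ∈ boxLabels M o) :
    y - o ∈ boxDom M := by
  rw [mem_boxDom]
  intro i
  obtain ⟨h1, h2⟩ := (mem_boxLabels.1 hy) i
  simp only [Pi.sub_apply]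
  constructor <;> linarith

variable (ℓ k : ℕ) (M : Fin (d + 1) → ℕ) (o : Fin (d + 1) → ℤ)

/-- the fine-site embedding `x ↦ x + L^k·o` of `□ = B^k(□₂)` ONTO the fine region over `□₂ + o` (r01's `boxEmb`).
[cite: Balaban1983RegularityDecay, §2 p. 575 «□_j is a cube of the size 2M», (1.1) p. 572] -/
abbrev eB : ↥(Box d ℓ k M) → ↥(fineDom ((ℓ + 1) ^ k) (boxLabels M o)) :=
  boxEmb ℓ k M o (shift_mem_boxLabels M o)

/-- the label embedding `y ↦ y + o` of `□₂` ONTO `□₂ + o` (r01's `boxEmbY`). [cite: Balaban1983RegularityDecay, (1.1) p. 572] -/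
abbrev eY : ↥(boxDom M) → ↥(boxLabels M o) := boxEmbY M o (shift_mem_boxLabels M o)

/-- `eY` is onto. [cite: Balaban1983RegularityDecay, (1.1) p. 572, dictionary] -/
theorem eY_surjective : Function.Surjective (eY M o) := by
  intro y
  refine ⟨⟨y.1 - o, sub_mem_boxDom y.2⟩, Subtype.ext ?_⟩
  show y.1 - o + o = y.1
  exact sub_add_cancel y.1 o

/-- `eB` is onto (r01's `inBox_iff`). [cite: Balaban1983RegularityDecay, (1.1) p. 572, dictionary] -/
theorem eB_surjective : Function.Surjective (eB (d := d) ℓ k M o) := by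
  intro x
  have hn : 1 ≤ (ℓ + 1) ^ k := Nat.one_le_pow _ _ (Nat.succ_pos ℓ)
  have hx : blk ((ℓ + 1) ^ k) x.1 ∈ boxLabels M o := (mem_fineDom hn).1 x.2
  have hin : B4RegionCubeCarrier.inBox ((ℓ + 1) ^ k) o M x := by
    intro i
    obtain ⟨h1, h2⟩ := (mem_boxLabels.1 hx) i
    exact ⟨h1, by exact_mod_cast h2⟩
  exact (B4RegionCubeCarrier.inBox_iff ℓ k M o (shift_mem_boxLabels M o) x).1 hin

/-- `eB` as an equivalence `□ ≃ fineDom L^k(□₂ + o)`. [cite: Balaban1983RegularityDecay, (1.1) p. 572, dictionary] -/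
def eBquiv : ↥(Box d ℓ k M) ≃ ↥(fineDom ((ℓ + 1) ^ k) (boxLabels M o)) :=
  Equiv.ofBijective (eB ℓ k M o) ⟨boxEmb_injective ℓ k M o (shift_mem_boxLabels M o), eB_surjective ℓ k M o⟩

/-- `eY` as an equivalence `□₂ ≃ □₂ + o`. [cite: Balaban1983RegularityDecay, (1.1) p. 572, dictionary] -/
def eYquiv : ↥(boxDom M) ≃ ↥(boxLabels M o) :=
  Equiv.ofBijective (eY M o) ⟨boxEmbY_injective M o (shift_mem_boxLabels M o), eY_surjective M o⟩

/-- `eBquiv` acts as `eB`. [cite: Balaban1983RegularityDecay, (1.1) p. 572, dictionary] -/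
@[simp] theorem eBquiv_apply (x : ↥(Box d ℓ k M)) : eBquiv ℓ k M o x = eB ℓ k M o x := rfl
/-- `eYquiv` acts as `eY`. [cite: Balaban1983RegularityDecay, (1.1) p. 572, dictionary] -/
@[simp] theorem eYquiv_apply (y : ↥(boxDom M)) : eYquiv M o y = eY M o y := rfl

/-- the product equivalence on `□ × ι` (sites × colours). [cite: Balaban1983RegularityDecay, (1.1) p. 572, dictionary] -/
def eBι : (↥(Box d ℓ k M) × ι) ≃ (↥(fineDom ((ℓ + 1) ^ k) (boxLabels M o)) × ι) :=
  (eBquiv ℓ k M o).prodCongr (Equiv.refl ι)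

/-- the product equivalence on `□₂ × ι`. [cite: Balaban1983RegularityDecay, (1.1) p. 572, dictionary] -/
def eYι : (↥(boxDom M) × ι) ≃ (↥(boxLabels M o) × ι) := (eYquiv M o).prodCongr (Equiv.refl ι)

omit [Fintype ι] [DecidableEq ι] in
/-- `eBι = eB × id`. [cite: Balaban1983RegularityDecay, (1.1) p. 572, dictionary] -/
theorem eBι_eq : ⇑(eBι (ι := ι) ℓ k M o) = Prod.map (eB ℓ k M o) id := by
  funext p; rfl

omit [Fintype ι] [DecidableEq ι] in
/-- `eYι = eY × id`. [cite: Balaban1983RegularityDecay, (1.1) p. 572, dictionary] -/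
theorem eYι_eq : ⇑(eYι (ι := ι) M o) = Prod.map (eY M o) id := by
  funext p; rfl

end Labels

/-! ## §2 The region operator (1.6) over `□₂ + o` reindexed along `eB` IS the box lineage's `opA` -/

section Transport

variable (F : OrthFlow ι) (e : ℝ) (ℓ k : ℕ) (a m2 : ℝ) (M : Fin (d + 1) → ℕ) (o : Fin (d + 1) → ℤ)
  (Ac : (Fin (d + 1) → ℤ) → Fin (d + 1) → ℝ)

/-- the mesh `L^k ≥ 1`. [cite: Balaban1983RegularityDecay, (1.1) p. 572] -/
theorem hnk : 1 ≤ (ℓ + 1) ^ k := Nat.one_le_pow _ _ (Nat.succ_pos ℓ)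

/-- the translated component field `A_ν(z + L^ko)` — `A^{(k)}|_□` in the box lineage's own coordinates.
[cite: Balaban1983RegularityDecay, p. 572 «A_{⟨x,x+ηe_μ⟩} = A_μ(x)»; Balaban1982Higgs2, (2.67) p. 572] -/
def shiftF (Ac : (Fin (d + 1) → ℤ) → Fin (d + 1) → ℝ) : (Fin (d + 1) → ℤ) → Fin (d + 1) → ℝ :=
  fun z => Ac (z + fun i => (((ℓ + 1) ^ k : ℕ) : ℤ) * o i)

/-- the region's bond function pulled back along `eB` is the translated component field's bond function (r01's
`compField_add`). [cite: Balaban1983RegularityDecay, p. 572 «A_{⟨x,x+ηe_μ⟩} = A_μ(x)»] -/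
theorem acBond_eB (u v : ↥(Box d ℓ k M)) :
    acBond (boxLabels M o) Ac (eB ℓ k M o u) (eB ℓ k M o v) = compField (shiftF ℓ k o Ac) u.1 v.1 :=
  compField_add Ac u.1 v.1 _

/-- no bond is cut when the site set is everything: `cutWt ⊤ c = c`. [cite: Balaban1983RegularityDecay, (1.3) p. 572, dictionary] -/
theorem cutWt_true {X : Type} (c : X → X → ℝ) : cutWt (fun _ : X => True) c = c := by
  funext z z'
  simp [cutWt]

/-- **`H_k(Ω_{□₂+o}, A)|_{eB} = H_k(□, A(·+L^ko))`**: r01's region operator (1.6) over the labels `□₂ + o`, reindexed along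
`eB`, IS the box lineage's operator `opA` with the corner embedding, the staircase contours and the translated component field
(bond weights, block weights, links and transporters restrict: r01's `regWt_boxEmb`, `rBlkWt_boxEmb`, `contourTrans_boxEmb`;
p17's `covOp_cut_submatrix` with nothing cut). [cite: Balaban1983RegularityDecay, (1.3)–(1.6) p. 572, §2 p. 575] -/
theorem regionOp_submatrix_eB :
    (regionOp F e (hnk ℓ k) (B1.aSeq a ((ℓ : ℝ) + 1) k) m2 (boxLabels M o) Ac).submatrix
        (Prod.map (eB ℓ k M o) id) (Prod.map (eB ℓ k M o) id)
      = opA d F (κS ℓ k e) ℓ k a m2 M (embS d ℓ k M) (ΓS d ℓ k M) (fun u v => compField (shiftF ℓ k o Ac) u.1 v.1) := by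
  have hn := hnk ℓ k
  have hS : ∀ z : ↥(fineDom ((ℓ + 1) ^ k) (boxLabels M o)), True ↔ ∃ a, eB ℓ k M o a = z :=
    fun z => ⟨fun _ => eB_surjective ℓ k M o z, fun _ => trivial⟩
  have hmain := covOp_cut_submatrix (fun _ => True) (boxEmb_injective ℓ k M o (shift_mem_boxLabels M o)) hS
    (boxEmbY_injective M o (shift_mem_boxLabels M o))
    (regWt ((ℓ + 1) ^ k) (fineDom ((ℓ + 1) ^ k) (boxLabels M o))) m2
    (B1.aSeq a ((ℓ : ℝ) + 1) k * (((((ℓ + 1) ^ k : ℕ) : ℝ)) ^ (d + 1))⁻¹)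
    (rBlkWt ((ℓ + 1) ^ k) (boxLabels M o) (fineDom ((ℓ + 1) ^ k) (boxLabels M o)))
    (fieldLink F (κS ℓ k e) (acBond (boxLabels M o) Ac))
    (contourTrans (fieldLink F (κS ℓ k e) (acBond (boxLabels M o) Ac)) (rbaseEmb hn (boxLabels M o))
      (rstairContour hn (boxLabels M o)))
    (fun y b h => rBlkWt_boxEmb_ne_zero ℓ k M o (shift_mem_boxLabels M o) h)
  rw [cutWt_true] at hmain
  have hc : (fun b b' => regWt ((ℓ + 1) ^ k) (fineDom ((ℓ + 1) ^ k) (boxLabels M o)) (eB ℓ k M o b) (eB ℓ k M o b'))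
      = boxWt ((ℓ + 1) ^ k) (fun i => (ℓ + 1) ^ k * M i) := by
    funext b b'
    exact regWt_boxEmb ℓ k M o (shift_mem_boxLabels M o) b b'
  have hq : (fun y' b => rBlkWt ((ℓ + 1) ^ k) (boxLabels M o) (fineDom ((ℓ + 1) ^ k) (boxLabels M o))
      (eY M o y') (eB ℓ k M o b)) = blkWt ((ℓ + 1) ^ k) M (fun i => (ℓ + 1) ^ k * M i) := by
    funext y' b
    exact rBlkWt_boxEmb ℓ k M o (shift_mem_boxLabels M o) y' b
  have hW : (fun b b' => fieldLink F (κS ℓ k e) (acBond (boxLabels M o) Ac) (eB ℓ k M o b) (eB ℓ k M o b'))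
      = fieldLink F (κS ℓ k e) (fun u v : ↥(Box d ℓ k M) => compField (shiftF ℓ k o Ac) u.1 v.1) := by
    funext b b'
    show F.U _ = F.U _
    rw [acBond_eB]
  have hT : (fun y' b => contourTrans (fieldLink F (κS ℓ k e) (acBond (boxLabels M o) Ac))
      (rbaseEmb hn (boxLabels M o)) (rstairContour hn (boxLabels M o)) (eY M o y') (eB ℓ k M o b))
      = contourTrans (fieldLink F (κS ℓ k e) (fun u v : ↥(Box d ℓ k M) => compField (shiftF ℓ k o Ac) u.1 v.1))
          (embS d ℓ k M) (ΓS d ℓ k M) := by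
    funext y' b
    rw [contourTrans_boxEmb ℓ k M o (shift_mem_boxLabels M o) F (κS ℓ k e)]
    have : (fun a b => acBond (boxLabels M o) Ac (boxEmb ℓ k M o (shift_mem_boxLabels M o) a)
        (boxEmb ℓ k M o (shift_mem_boxLabels M o) b))
        = (fun u v : ↥(Box d ℓ k M) => compField (shiftF ℓ k o Ac) u.1 v.1) := by
      funext u v; exact acBond_eB ℓ k M o Ac u v
    rw [this]
    rfl
  show (b4Op F (e / (((ℓ + 1) ^ k : ℕ) : ℝ)) _ m2 _ _ _ _ _).submatrix _ _ = _
  rw [b4Op]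
  rw [show e / (((ℓ + 1) ^ k : ℕ) : ℝ) = κS ℓ k e from rfl] at *
  rw [hmain, hc, hq, hW, hT]
  rfl


/-- `greenA = (opA)⁻¹` (definitional). [cite: Balaban1983RegularityDecay, (1.6) p. 572] -/
theorem greenA_eq_inv (κ : ℝ) (A : ↥(Box d ℓ k M) → ↥(Box d ℓ k M) → ℝ) :
    greenA d F κ ℓ k a m2 M (embS d ℓ k M) (ΓS d ℓ k M) A = (opA d F κ ℓ k a m2 M (embS d ℓ k M) (ΓS d ℓ k M) A)⁻¹ :=
  rfl

/-- **`G_k(Ω_{□₂+o}, A)|_{eB} = G_k(□, A(·+L^ko))`**: the inverse commutes with the reindexing along a bijection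
(`Matrix.inv_submatrix_equiv`). [cite: Balaban1983RegularityDecay, (1.6) p. 572] -/
theorem green_submatrix_eB :
    ((regionOp F e (hnk ℓ k) (B1.aSeq a ((ℓ : ℝ) + 1) k) m2 (boxLabels M o) Ac)⁻¹).submatrix
        (Prod.map (eB ℓ k M o) id) (Prod.map (eB ℓ k M o) id)
      = greenA d F (κS ℓ k e) ℓ k a m2 M (embS d ℓ k M) (ΓS d ℓ k M) (fun u v => compField (shiftF ℓ k o Ac) u.1 v.1) := by
  rw [greenA_eq_inv, ← regionOp_submatrix_eB, ← eBι_eq, Matrix.inv_submatrix_equiv]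

/-- **`Q_k(A)|_{eY × eB} = Q_k(A(·+L^ko))`**: the carrier's averaging operator (1.4) over `□₂ + o` reindexed is the box
lineage's `avgA`. [cite: Balaban1983RegularityDecay, (1.4) p. 572; Balaban1982Higgs2, p. 570 «Q_k^*(A)»] -/
theorem avgQ_submatrix_eB :
    (avgQ F (κS ℓ k e) (hnk ℓ k) (boxLabels M o) (acBond (boxLabels M o) Ac)).submatrix
        (Prod.map (eY M o) id) (Prod.map (eB ℓ k M o) id)
      = avgA d F (κS ℓ k e) ℓ k M (embS d ℓ k M) (ΓS d ℓ k M) (fun u v => compField (shiftF ℓ k o Ac) u.1 v.1) := by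
  ext ⟨y', i⟩ ⟨b, j⟩
  simp only [Matrix.submatrix_apply, Prod.map_apply, id_eq, avgQ, avgA, avgOp, blockOp_apply]
  rw [rBlkWt_boxEmb ℓ k M o (shift_mem_boxLabels M o) y' b,
    contourTrans_boxEmb ℓ k M o (shift_mem_boxLabels M o) F (κS ℓ k e)]
  have : (fun a b => acBond (boxLabels M o) Ac (boxEmb ℓ k M o (shift_mem_boxLabels M o) a)
      (boxEmb ℓ k M o (shift_mem_boxLabels M o) b))
      = (fun u v : ↥(Box d ℓ k M) => compField (shiftF ℓ k o Ac) u.1 v.1) := by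
    funext u v; exact acBond_eB ℓ k M o Ac u v
  rw [this]
  rfl

/-- **THE KERNEL `G_k(Ω,A)Q_k^*(A)` RESTRICTS ENTRYWISE**: the `(eB x, eY y′)` entries of `G_kQ_kᵀ` of the region over
`□₂ + o` are the `(x, y′)` entries of `greenA · avgAᵀ` of the box (`Matrix.submatrix_mul_equiv`).
[cite: Balaban1982Higgs2, (2.58) p. 570; Balaban1983RegularityDecay, (1.4)–(1.6) p. 572] -/
theorem greenQ_apply_eB (x : ↥(Box d ℓ k M)) (y' : ↥(boxDom M)) (i j : ι) :
    ((regionOp F e (hnk ℓ k) (B1.aSeq a ((ℓ : ℝ) + 1) k) m2 (boxLabels M o) Ac)⁻¹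
        * (avgQ F (κS ℓ k e) (hnk ℓ k) (boxLabels M o) (acBond (boxLabels M o) Ac))ᵀ) (eB ℓ k M o x, i) (eY M o y', j)
      = (greenA d F (κS ℓ k e) ℓ k a m2 M (embS d ℓ k M) (ΓS d ℓ k M) (fun u v => compField (shiftF ℓ k o Ac) u.1 v.1)
          * (avgA d F (κS ℓ k e) ℓ k M (embS d ℓ k M) (ΓS d ℓ k M) (fun u v => compField (shiftF ℓ k o Ac) u.1 v.1))ᵀ)
          (x, i) (y', j) := by
  rw [← green_submatrix_eB, ← avgQ_submatrix_eB, Matrix.transpose_submatrix, ← eBι_eq, ← eYι_eq,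
    Matrix.submatrix_mul_equiv]
  rfl

omit [DecidableEq ι] in
/-- a kernel block applied to a vector is the value of the operator on the point source: `T[x,y]v = (T(vδ_y))(x)`.
[cite: Balaban1982Higgs2, Prop. 2.2 (2.58) p. 570, dictionary] -/
theorem block_mulVec_eq_fld {X Y : Type} [Fintype Y] [DecidableEq Y] (T : Matrix (X × ι) (Y × ι) ℝ) (x : X) (y : Y)
    (v : ι → ℝ) : (Matrix.of fun i j => T (x, i) (y, j)) *ᵥ v = fld (T *ᵥ single y v) x := by
  funext i
  simp only [mulVec, dotProduct, Matrix.of_apply, fld_apply, Fintype.sum_prod_type]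
  rw [Finset.sum_eq_single y]
  · refine Finset.sum_congr rfl fun j _ => ?_
    simp [B2Prop22RegularRegionPair.single]
  · intro y'' _ hy''
    refine Finset.sum_eq_zero fun j _ => ?_
    simp [B2Prop22RegularRegionPair.single, hy'']
  · intro h; exact absurd (Finset.mem_univ y) h

/-- **`kerBox` IS THE REGION KERNEL**: `a_k(G_k(□,Ã)Q_k^*(Ã))(x,y′)v = a_k·(G_k(Ω_{□₂+o},A)f_{y′+o, v})(x + L^ko)` for
`Ã = A₀ + A′ = A(·+L^ko)` in component form, with r01's region `Ω_{□₂+o} = fineDom L^k (□₂ + o)` and p23 g14's source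
`f_{y,v} = Q_k^*(A)(vδ_y)`. [cite: Balaban1982Higgs2, (2.58) p. 570, (2.67) p. 572; Balaban1983RegularityDecay, (1.6) p. 572] -/
theorem kerBox_mulVec_eq (A₀ : Fin (d + 1) → ℝ) (hA : constBond A₀ Subtype.val + AprS d ℓ k M A₀ (shiftF ℓ k o Ac)
      = fun u v => compField (shiftF ℓ k o Ac) u.1 v.1)
    (x : ↥(Box d ℓ k M)) (y' : ↥(boxDom M)) (v : ι → ℝ) :
    kerBox d F (κS ℓ k e) ℓ k a m2 M (embS d ℓ k M) (ΓS d ℓ k M) A₀ (AprS d ℓ k M A₀ (shiftF ℓ k o Ac)) x y' *ᵥ v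
      = B1.aSeq a ((ℓ : ℝ) + 1) k •
          fld ((regionOp F e (hnk ℓ k) (B1.aSeq a ((ℓ : ℝ) + 1) k) m2 (boxLabels M o) Ac)⁻¹
            *ᵥ srcQ F (κS ℓ k e) (hnk ℓ k) (boxLabels M o) (acBond (boxLabels M o) Ac) (eY M o y') v) (eB ℓ k M o x) := by
  rw [← fld_mul_avgQ_transpose_mulVec_single, ← block_mulVec_eq_fld, ← Matrix.smul_mulVec]
  congr 1
  ext i j
  simp only [kerBox, Matrix.of_apply, Matrix.smul_apply, hA, greenQ_apply_eB]


/-! ### Derivatives along the translation -/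

/-- the forward neighbour of an embedded site is the embedded forward neighbour. [cite: Balaban1983RegularityDecay, (1.3) p. 572, dictionary] -/
theorem boxEmb_add_e1 {Ωc : Finset (Fin (d + 1) → ℤ)} (ho : ∀ y : ↥(boxDom M), y.1 + o ∈ Ωc) (μ : Fin (d + 1))
    (x : ↥(Box d ℓ k M)) (h : x.1 + e1 μ ∈ Box d ℓ k M) :
    (boxEmb ℓ k M o ho x).1 + e1 μ = (boxEmb ℓ k M o ho ⟨x.1 + e1 μ, h⟩).1 := by
  show (x.1 + _) + e1 μ = (x.1 + e1 μ) + _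
  exact add_right_comm _ _ _

/-- a bond of the box maps to a bond of the region. [cite: Balaban1983RegularityDecay, (1.3) p. 572, dictionary] -/
theorem boxEmb_add_e1_mem {Ωc : Finset (Fin (d + 1) → ℤ)} (ho : ∀ y : ↥(boxDom M), y.1 + o ∈ Ωc) (μ : Fin (d + 1))
    (x : ↥(Box d ℓ k M)) (h : x.1 + e1 μ ∈ Box d ℓ k M) :
    (boxEmb ℓ k M o ho x).1 + e1 μ ∈ fineDom ((ℓ + 1) ^ k) Ωc := by
  rw [boxEmb_add_e1 ℓ k M o ho μ x h]
  exact (boxEmb ℓ k M o ho ⟨x.1 + e1 μ, h⟩).2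

/-- the region's link variable `U(eηA_b)` on an embedded bond is the box's link of the translated field.
[cite: Balaban1983RegularityDecay, (1.2) p. 572] -/
theorem fieldLink_boxEmb {Ωc : Finset (Fin (d + 1) → ℤ)} (ho : ∀ y : ↥(boxDom M), y.1 + o ∈ Ωc)
    (u v : ↥(Box d ℓ k M)) :
    fieldLink F (e / (((ℓ + 1) ^ k : ℕ) : ℝ)) (fun a b : ↥(fineDom ((ℓ + 1) ^ k) Ωc) => compField Ac a.1 b.1)
        (boxEmb ℓ k M o ho u) (boxEmb ℓ k M o ho v)
      = fieldLink F (κS ℓ k e) (fun a b : ↥(Box d ℓ k M) => compField (shiftF ℓ k o Ac) a.1 b.1) u v := by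
  dsimp only [fieldLink]
  rw [show compField Ac (boxEmb ℓ k M o ho u).1 (boxEmb ℓ k M o ho v).1 = compField (shiftF ℓ k o Ac) u.1 v.1 from
    compField_add Ac u.1 v.1 _]
  rfl

/-- **`D^η_{A,μ}` ALONG THE TRANSLATION, ON A BOND OF THE BOX**: for any region containing `□₂ + o` and any field `Φ` on
it, `(D^η_{A,μ}Φ)(x + L^ko) = L^k(U(eηA(·+L^ko)(x, x+e_μ))Φ(x + e_μ + L^ko) − Φ(x + L^ko))`.
[cite: Balaban1983RegularityDecay, (1.3) p. 572] -/
theorem fld_regionDeriv_boxEmb {Ωc : Finset (Fin (d + 1) → ℤ)} (ho : ∀ y : ↥(boxDom M), y.1 + o ∈ Ωc)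
    (μ : Fin (d + 1)) (Φ : ↥(fineDom ((ℓ + 1) ^ k) Ωc) × ι → ℝ) (x : ↥(Box d ℓ k M)) (h : x.1 + e1 μ ∈ Box d ℓ k M) :
    fld (regionDeriv F e ((ℓ + 1) ^ k) Ωc Ac μ *ᵥ Φ) (boxEmb ℓ k M o ho x)
      = ((((ℓ + 1) ^ k : ℕ) : ℝ)) •
          (fieldLink F (κS ℓ k e) (fun a b : ↥(Box d ℓ k M) => compField (shiftF ℓ k o Ac) a.1 b.1) x ⟨x.1 + e1 μ, h⟩
              *ᵥ fld Φ (boxEmb ℓ k M o ho ⟨x.1 + e1 μ, h⟩)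
            - fld Φ (boxEmb ℓ k M o ho x)) := by
  have hmem := boxEmb_add_e1_mem ℓ k M o ho μ x h
  rw [regionDeriv, fld_covDeriv_mulVec_of_mem _ _ Φ hmem]
  have hpt : (⟨(boxEmb ℓ k M o ho x).1 + e1 μ, hmem⟩ : ↥(fineDom ((ℓ + 1) ^ k) Ωc)) = boxEmb ℓ k M o ho ⟨x.1 + e1 μ, h⟩ :=
    Subtype.ext (boxEmb_add_e1 ℓ k M o ho μ x h)
  rw [hpt, fieldLink_boxEmb]

/-- no bond of the box, no bond of the region over `□₂ + o` (Neumann conditions on `∂□`).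
[cite: Balaban1983RegularityDecay, (1.3) p. 572 «the summation is over … bonds … with end-points in Ω»] -/
theorem eB_add_e1_not_mem (μ : Fin (d + 1)) (x : ↥(Box d ℓ k M)) (h : x.1 + e1 μ ∉ Box d ℓ k M) :
    (eB ℓ k M o x).1 + e1 μ ∉ fineDom ((ℓ + 1) ^ k) (boxLabels M o) := by
  intro hmem
  obtain ⟨z, hz⟩ := eB_surjective ℓ k M o ⟨_, hmem⟩
  have hval : z.1 + (fun i => (((ℓ + 1) ^ k : ℕ) : ℤ) * o i) = x.1 + (fun i => (((ℓ + 1) ^ k : ℕ) : ℤ) * o i) + e1 μ :=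
    congrArg Subtype.val hz
  have : z.1 = x.1 + e1 μ := by
    have := congrArg (fun w => w - fun i => (((ℓ + 1) ^ k : ℕ) : ℤ) * o i) hval
    simpa [add_right_comm] using this
  exact h (this ▸ z.2)

/-- **`dkerBox` IS THE REGION'S DERIVATIVE KERNEL**: `a_k(D^η_{Ã,μ}G_k(□,Ã)Q_k^*(Ã))((x,x+e_μ),y′)v =
a_k·(D^η_{A,μ}G_k(Ω_{□₂+o},A)f_{y′+o,v})(x + L^ko)` (both sides vanish when `x + e_μ ∉ □`).
[cite: Balaban1982Higgs2, (2.58) p. 570, (2.67) p. 572 «the same equality for the covariant derivative»; Balaban1983RegularityDecay, (1.3) p. 572] -/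
theorem dkerBox_mulVec_eq (A₀ : Fin (d + 1) → ℝ) (hA : constBond A₀ Subtype.val + AprS d ℓ k M A₀ (shiftF ℓ k o Ac)
      = fun u v => compField (shiftF ℓ k o Ac) u.1 v.1)
    (μ : Fin (d + 1)) (x : ↥(Box d ℓ k M)) (y' : ↥(boxDom M)) (v : ι → ℝ) :
    dkerBox d F (κS ℓ k e) ℓ k a m2 M (embS d ℓ k M) (ΓS d ℓ k M) A₀ (AprS d ℓ k M A₀ (shiftF ℓ k o Ac)) μ x y' *ᵥ v
      = B1.aSeq a ((ℓ : ℝ) + 1) k •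
          fld (regionDeriv F e ((ℓ + 1) ^ k) (boxLabels M o) Ac μ
            *ᵥ ((regionOp F e (hnk ℓ k) (B1.aSeq a ((ℓ : ℝ) + 1) k) m2 (boxLabels M o) Ac)⁻¹
              *ᵥ srcQ F (κS ℓ k e) (hnk ℓ k) (boxLabels M o) (acBond (boxLabels M o) Ac) (eY M o y') v)) (eB ℓ k M o x) := by
  -- the box side as the derivative of the field `z ↦ kerBox z y′ v`
  set Ψ : ↥(Box d ℓ k M) × ι → ℝ := (B1.aSeq a ((ℓ : ℝ) + 1) k •
      (greenA d F (κS ℓ k e) ℓ k a m2 M (embS d ℓ k M) (ΓS d ℓ k M) (fun u v => compField (shiftF ℓ k o Ac) u.1 v.1)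
        * (avgA d F (κS ℓ k e) ℓ k M (embS d ℓ k M) (ΓS d ℓ k M) (fun u v => compField (shiftF ℓ k o Ac) u.1 v.1))ᵀ))
      *ᵥ single y' v with hΨdef
  set Φ : ↥(fineDom ((ℓ + 1) ^ k) (boxLabels M o)) × ι → ℝ :=
    (regionOp F e (hnk ℓ k) (B1.aSeq a ((ℓ : ℝ) + 1) k) m2 (boxLabels M o) Ac)⁻¹
      *ᵥ srcQ F (κS ℓ k e) (hnk ℓ k) (boxLabels M o) (acBond (boxLabels M o) Ac) (eY M o y') v with hΦdef
  have hΨ : ∀ z, fld Ψ z = B1.aSeq a ((ℓ : ℝ) + 1) k • fld Φ (eB ℓ k M o z) := by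
    intro z
    rw [hΨdef, ← block_mulVec_eq_fld, ← kerBox_mulVec_eq F e ℓ k a m2 M o Ac A₀ hA z y' v]
    simp only [kerBox, hA]
  have hL : dkerBox d F (κS ℓ k e) ℓ k a m2 M (embS d ℓ k M) (ΓS d ℓ k M) A₀ (AprS d ℓ k M A₀ (shiftF ℓ k o Ac)) μ x y'
        *ᵥ v
      = fld (derivA d F (κS ℓ k e) ℓ k M (fun u v => compField (shiftF ℓ k o Ac) u.1 v.1) μ *ᵥ Ψ) x := by
    rw [hΨdef, Matrix.mulVec_mulVec, ← block_mulVec_eq_fld]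
    simp only [dkerBox, hA]
  rw [hL]
  by_cases h : x.1 + e1 μ ∈ Box d ℓ k M
  · rw [derivA, fld_covDeriv_mulVec_of_mem _ _ Ψ h, hΨ, hΨ,
      fld_regionDeriv_boxEmb F e ℓ k M o Ac (shift_mem_boxLabels M o) μ Φ x h, Matrix.mulVec_smul, ← smul_sub,
      smul_comm]
  · rw [derivA, B4Lemma21Region.fld_covDeriv_mulVec_of_not_mem _ _ Ψ h, regionDeriv,
      B4Lemma21Region.fld_covDeriv_mulVec_of_not_mem _ _ _ (eB_add_e1_not_mem ℓ k M o μ x h), smul_zero]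

end Transport

/-! ## §3 The distance bookkeeping: label distance versus the source distance and the depth in `□` -/

section Geometry

variable (ℓ k : ℕ) (M : Fin (d + 1) → ℕ) (o : Fin (d + 1) → ℤ)

omit [Fintype ι] [DecidableEq ι] in
/-- **LABEL DISTANCE ≤ SOURCE DISTANCE + 1**: for a fine point `u` of the block `B^k(b)` and a label `z`,
`L^k·(|b − z|_∞ − 1) ≤ |u − L^kz|_∞` (the printed `dist(b, y)`, `y` the base corner `L^ky`, against the block-label distance).
[cite: Balaban1982Higgs2, (2.58) p. 570 «dist(b, y)», dictionary] -/
theorem supNorm_label_le {n : ℕ} (hn : 1 ≤ n) {u b : Fin (d + 1) → ℤ} (hb : blk n u = b) (z : Fin (d + 1) → ℤ) :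
    (n : ℝ) * (supNorm (b - z) - 1) ≤ supNorm (u - fun i => (n : ℤ) * z i) := by
  obtain ⟨μ, hμ⟩ := exists_supNorm_eq (b - z)
  obtain ⟨hlow, hup⟩ := base_le_of_blk hn hb
  have h1 : ((n : ℤ) : ℝ) * ((b μ : ℤ) : ℝ) ≤ ((u μ : ℤ) : ℝ) := by exact_mod_cast hlow μ
  have h2 : ((u μ : ℤ) : ℝ) - ((n : ℤ) : ℝ) * ((b μ : ℤ) : ℝ) ≤ ((n : ℤ) : ℝ) := by exact_mod_cast hup μ
  have h3 := abs_le_supNorm (u - fun i => (n : ℤ) * z i) μ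
  rw [Pi.sub_apply, Int.cast_abs, Int.cast_sub, Int.cast_mul] at h3
  rw [hμ, Pi.sub_apply, Int.cast_abs, Int.cast_sub]
  have hn0 : (0 : ℝ) ≤ ((n : ℤ) : ℝ) := by exact_mod_cast (Nat.zero_le n)
  have hnn : ((n : ℤ) : ℝ) = (n : ℝ) := by norm_cast
  rw [hnn] at h1 h2 h3 hn0
  refine le_trans ?_ h3
  rcases le_or_gt 0 (((b μ : ℤ) : ℝ) - ((z μ : ℤ) : ℝ)) with hpos | hneg
  · rw [abs_of_nonneg hpos]
    have : (n : ℝ) * (((b μ : ℤ) : ℝ) - ((z μ : ℤ) : ℝ)) ≤ ((u μ : ℤ) : ℝ) - (n : ℝ) * ((z μ : ℤ) : ℝ) := by nlinarith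
    have h4 : (n : ℝ) * (((b μ : ℤ) : ℝ) - ((z μ : ℤ) : ℝ) - 1) ≤ (n : ℝ) * (((b μ : ℤ) : ℝ) - ((z μ : ℤ) : ℝ)) := by
      nlinarith
    exact h4.trans (this.trans (le_abs_self _))
  · rw [abs_of_neg hneg]
    have : (n : ℝ) * (-(((b μ : ℤ) : ℝ) - ((z μ : ℤ) : ℝ)) - 1) ≤ -(((u μ : ℤ) : ℝ) - (n : ℝ) * ((z μ : ℤ) : ℝ)) := by
      nlinarith
    exact this.trans (neg_le_abs _)

omit [Fintype ι] [DecidableEq ι] in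
/-- membership in the fine region over the labels `□₂ + o`, in coordinates: `L^ko_μ ≤ z_μ < L^k(o_μ + M_μ)`.
[cite: Balaban1983RegularityDecay, (1.1) p. 572, dictionary] -/
theorem mem_fineDom_boxLabels_iff {n : ℕ} (hn : 1 ≤ n) (z : Fin (d + 1) → ℤ) :
    z ∈ fineDom n (boxLabels M o) ↔ ∀ i, (n : ℤ) * o i ≤ z i ∧ z i < (n : ℤ) * (o i + M i) := by
  have hn0 : (0 : ℤ) < n := by exact_mod_cast hn
  rw [mem_fineDom hn, mem_boxLabels]
  refine forall_congr' fun i => ?_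
  simp only [blk]
  rw [Int.le_ediv_iff_mul_le hn0, Int.ediv_lt_iff_lt_mul hn0, mul_comm (o i), mul_comm (o i + M i)]

omit [Fintype ι] [DecidableEq ι] in
/-- **THE DEPTH OF `B^k(y)` IN `□` BOUNDS `dist(x, □^c)`**: under the `deep` clause of the model (`R` unit blocks between
`B^k(y)` and `∂□`), every fine point `z ∉ □ + L^ko` is at sup-distance `≥ R·L^k` from `x + L^ko` — the printed restriction
`dist(b, Ω^c) ≥ R₀` for `Ω = □` once `R ≥ R₀`. [cite: Balaban1982Higgs2, Prop. 2.2 (2.58) p. 570; p. 571 «for b ⊂ Ω, dist(b, Ω^c) ≧ R₀», p. 572 «distant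
from the point y less than … 4r(L^kε)»] -/
theorem deep_supNorm_le {R : ℕ} (x : ↥(Box d ℓ k M))
    (hdeep : ∀ i, ((R * (ℓ + 1) ^ k : ℕ) : ℤ) ≤ x.1 i ∧ x.1 i + (R * (ℓ + 1) ^ k : ℕ) + 1 ≤ (((ℓ + 1) ^ k * M i : ℕ) : ℤ))
    {z : Fin (d + 1) → ℤ} (hz : z ∉ fineDom ((ℓ + 1) ^ k) (boxLabels M o)) :
    (R : ℝ) * ((((ℓ + 1) ^ k : ℕ) : ℝ)) ≤ supNorm ((eB ℓ k M o x).1 - z) := by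
  rw [mem_fineDom_boxLabels_iff M o (hnk ℓ k)] at hz
  push Not at hz
  obtain ⟨i, hi⟩ := hz
  have h3 := abs_le_supNorm ((eB ℓ k M o x).1 - z) i
  refine le_trans ?_ h3
  rw [Pi.sub_apply, Int.cast_abs, Int.cast_sub]
  have hxi : ((eB ℓ k M o x).1 i : ℤ) = x.1 i + (((ℓ + 1) ^ k : ℕ) : ℤ) * o i := rfl
  rw [hxi]
  obtain ⟨hd1, hd2⟩ := hdeep i
  have hd1' : (R : ℝ) * ((((ℓ + 1) ^ k : ℕ) : ℝ)) ≤ ((x.1 i : ℤ) : ℝ) := by exact_mod_cast hd1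
  have hd2' : ((x.1 i : ℤ) : ℝ) + (R : ℝ) * ((((ℓ + 1) ^ k : ℕ) : ℝ)) + 1 ≤ ((((ℓ + 1) ^ k : ℕ) : ℝ)) * (M i : ℝ) := by
    exact_mod_cast hd2
  by_cases hlt : z i < (((ℓ + 1) ^ k : ℕ) : ℤ) * o i
  · have hlt' : ((z i : ℤ) : ℝ) < ((((ℓ + 1) ^ k : ℕ) : ℝ)) * ((o i : ℤ) : ℝ) := by exact_mod_cast hlt
    rw [Int.cast_add, Int.cast_mul, Int.cast_natCast]
    refine le_trans ?_ (le_abs_self _)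
    linarith
  · have hge := hi (le_of_not_gt hlt)
    have hge' : ((((ℓ + 1) ^ k : ℕ) : ℝ)) * (((o i : ℤ) : ℝ) + (M i : ℝ)) ≤ ((z i : ℤ) : ℝ) := by exact_mod_cast hge
    rw [Int.cast_add, Int.cast_mul, Int.cast_natCast]
    refine le_trans ?_ (neg_le_abs _)
    nlinarith

end Geometry

/-! ## §4 The constants of Proposition 2.2 (2.58) on r01's region pairs, chosen once -/

section Const

variable [Nonempty ι] (F : OrthFlow ι) {ℓ₁ : ℝ} (hℓ₁ : 0 ≤ ℓ₁)
  (hLip : ∀ t (v : ι → ℝ), ((F.U t - 1) *ᵥ v) ⬝ᵥ ((F.U t - 1) *ᵥ v) ≤ (ℓ₁ * t) ^ 2 * (v ⬝ᵥ v))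
  (d ℓ : ℕ) (hℓ : 1 ≤ ℓ) (amin aplus m2plus : ℝ) (ha : 0 < amin) (creg β : ℝ) (hcreg : 0 ≤ creg) (hβ : 0 < β)

/-- `δ₀` of (2.58) on r01's region-pair family (chosen once per frame data). [cite: Balaban1982Higgs2, Prop. 2.2 (2.58) p. 570] -/
def dP : ℝ := (B2Prop22RegularRegionPair.ineq258_regionPairFam F hℓ₁ hLip d ℓ hℓ amin aplus m2plus ha creg β hcreg hβ).choose

/-- `c₀` of (2.58). [cite: Balaban1982Higgs2, Prop. 2.2 (2.58) p. 570] -/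
def cP : ℝ :=
  (B2Prop22RegularRegionPair.ineq258_regionPairFam F hℓ₁ hLip d ℓ hℓ amin aplus m2plus ha creg β hcreg hβ).choose_spec.choose

/-- `R₀` of (2.58). [cite: Balaban1982Higgs2, Prop. 2.2 (2.58) p. 570; p. 571 «for b ⊂ Ω, dist(b, Ω^c) ≧ R₀»] -/
def rP : ℝ :=
  (B2Prop22RegularRegionPair.ineq258_regionPairFam F hℓ₁ hLip d ℓ hℓ amin aplus m2plus ha creg β hcreg
    hβ).choose_spec.choose_spec.choose

/-- `e₁` of (2.58) («for e(L^kε) sufficiently small»). [cite: Balaban1982Higgs2, Prop. 2.2 p. 570] -/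
def eP : ℝ :=
  (B2Prop22RegularRegionPair.ineq258_regionPairFam F hℓ₁ hLip d ℓ hℓ amin aplus m2plus ha creg β hcreg
    hβ).choose_spec.choose_spec.choose_spec.choose

/-- the big-block modulus `M` of (2.58) («depending on d, a, M»; r01's `Kmod`). [cite: Balaban1982Higgs2, Prop. 2.2 p. 570; Balaban1983RegularityDecay, p. 575] -/
abbrev KP : ℕ := B4ThmRegionPairEta.Kmod F hℓ₁ hLip d ℓ hℓ amin aplus m2plus ha

/-- the defining property of the four constants: (2.58), ALL FOUR CLAUSES, at every regular field on r01's family (p23 g14's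
`ineq258_regionPairFam`). [cite: Balaban1982Higgs2, Prop. 2.2 (2.58) pp. 570–571] -/
theorem P_spec :
    0 < dP F hℓ₁ hLip d ℓ hℓ amin aplus m2plus ha creg β hcreg hβ ∧ 0 < cP F hℓ₁ hLip d ℓ hℓ amin aplus m2plus ha creg β hcreg hβ ∧
    0 < rP F hℓ₁ hLip d ℓ hℓ amin aplus m2plus ha creg β hcreg hβ ∧ 0 < eP F hℓ₁ hLip d ℓ hℓ amin aplus m2plus ha creg β hcreg hβ ∧
    ∀ i : B4ThmRegionPairEta.RegionPairInst d ℓ amin aplus m2plus,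
      (B4ThmRegionPairEta.regionPairFam F d ℓ amin aplus m2plus creg β (KP F hℓ₁ hLip d ℓ hℓ amin aplus m2plus ha) i).regular →
      (B4ThmRegionPairEta.regionPairFam F d ℓ amin aplus m2plus creg β (KP F hℓ₁ hLip d ℓ hℓ amin aplus m2plus ha) i).bigBlocks →
      0 < i.e → i.e ≤ eP F hℓ₁ hLip d ℓ hℓ amin aplus m2plus ha creg β hcreg hβ →
      ∀ (x : ↥(fineDom ((ℓ + 1) ^ i.k) i.Ωc)) (y : ↥i.Ωc) (v : ι → ℝ),
        rP F hℓ₁ hLip d ℓ hℓ amin aplus m2plus ha creg β hcreg hβ ≤ i.cdist x →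
        siteNorm (fld (i.GΩ F *ᵥ B2Prop22RegularRegionPair.lsrc F i y v) x)
            ≤ cP F hℓ₁ hLip d ℓ hℓ amin aplus m2plus ha creg β hcreg hβ
              * Real.exp (-(dP F hℓ₁ hLip d ℓ hℓ amin aplus m2plus ha creg β hcreg hβ * B2Prop22RegularRegionPair.ldist i x y))
              * siteNorm v ∧
        (∀ μ : Fin (d + 1), x.1 + e1 μ ∈ fineDom ((ℓ + 1) ^ i.k) i.Ωc →
          siteNorm (fld (i.DΩ F μ *ᵥ (i.GΩ F *ᵥ B2Prop22RegularRegionPair.lsrc F i y v)) x)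
            ≤ cP F hℓ₁ hLip d ℓ hℓ amin aplus m2plus ha creg β hcreg hβ
              * Real.exp (-(dP F hℓ₁ hLip d ℓ hℓ amin aplus m2plus ha creg β hcreg hβ * B2Prop22RegularRegionPair.ldist i x y))
              * siteNorm v) ∧
        siteNorm (fld (i.deltaV F (B2Prop22RegularRegionPair.lsrc F i y v)) x)
          ≤ cP F hℓ₁ hLip d ℓ hℓ amin aplus m2plus ha creg β hcreg hβ
              * Real.exp (-(dP F hℓ₁ hLip d ℓ hℓ amin aplus m2plus ha creg β hcreg hβ * B2Prop22RegularRegionPair.ldist i x y))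
              * Real.exp (-(dP F hℓ₁ hLip d ℓ hℓ amin aplus m2plus ha creg β hcreg hβ
                  * (i.cdist x + i.cdist (B2Prop22RegularRegionPair.lbase i y)))) * siteNorm v ∧
        (∀ μ : Fin (d + 1), x.1 + e1 μ ∈ fineDom ((ℓ + 1) ^ i.k) i.Ωc →
          siteNorm (fld (i.DΩ F μ *ᵥ i.deltaV F (B2Prop22RegularRegionPair.lsrc F i y v)) x)
            ≤ cP F hℓ₁ hLip d ℓ hℓ amin aplus m2plus ha creg β hcreg hβ
              * Real.exp (-(dP F hℓ₁ hLip d ℓ hℓ amin aplus m2plus ha creg β hcreg hβ * B2Prop22RegularRegionPair.ldist i x y))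
              * Real.exp (-(dP F hℓ₁ hLip d ℓ hℓ amin aplus m2plus ha creg β hcreg hβ
                  * (i.cdist x + i.cdist (B2Prop22RegularRegionPair.lbase i y)))) * siteNorm v) :=
  (B2Prop22RegularRegionPair.ineq258_regionPairFam F hℓ₁ hLip d ℓ hℓ amin aplus m2plus ha creg β hcreg
    hβ).choose_spec.choose_spec.choose_spec.choose_spec

end Const

/-! ## §5 Frames linked to the constants of (2.58) -/

variable (ι) in
/-- a `FrameS` whose free Proposition-2.2 constants `cO`, `δO`, `SO` (of `B2Lemma24Proof.Frame`) dominate the constants of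
the tree's (2.58): `δO ≤ δ₀`, `a₊·c₀·e^{δ₀} ≤ cO`, and the lattice-sum constant `K_{d+1}(δO/2) ≤ SO`.
[cite: Balaban1982Higgs2, Prop. 2.2 (2.58) p. 570, Lemma 2.4 p. 572] -/
structure FrameU (d : ℕ) [Nonempty ι] extends FrameS ι d where
  hδP : δO ≤ dP F hℓ₁ hLip d ℓ hℓ amin aplus m2plus ha creg β hcreg hβ
  hcP : aplus * cP F hℓ₁ hLip d ℓ hℓ amin aplus m2plus ha creg β hcreg hβ
    * Real.exp (dP F hℓ₁ hLip d ℓ hℓ amin aplus m2plus ha creg β hcreg hβ) ≤ cO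
  hSP : B4Sect5Proof.latticeConst (d + 1) (δO / 2) ≤ SO

namespace FrameU

variable [Nonempty ι] {d : ℕ} (fr : FrameU ι d)

/-- `δ₀` of (2.58) for the frame. [cite: Balaban1982Higgs2, (2.58) p. 570] -/
abbrev dP1 : ℝ := dP fr.F fr.hℓ₁ fr.hLip d fr.ℓ fr.hℓ fr.amin fr.aplus fr.m2plus fr.ha fr.creg fr.β fr.hcreg fr.hβ
/-- `c₀` of (2.58) for the frame. [cite: Balaban1982Higgs2, (2.58) p. 570] -/
abbrev cP1 : ℝ := cP fr.F fr.hℓ₁ fr.hLip d fr.ℓ fr.hℓ fr.amin fr.aplus fr.m2plus fr.ha fr.creg fr.β fr.hcreg fr.hβ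
/-- `R₀` of (2.58) for the frame. [cite: Balaban1982Higgs2, (2.58) p. 571] -/
abbrev rP1 : ℝ := rP fr.F fr.hℓ₁ fr.hLip d fr.ℓ fr.hℓ fr.amin fr.aplus fr.m2plus fr.ha fr.creg fr.β fr.hcreg fr.hβ
/-- `e₁` of (2.58) for the frame. [cite: Balaban1982Higgs2, Prop. 2.2 p. 570] -/
abbrev eP1 : ℝ := eP fr.F fr.hℓ₁ fr.hLip d fr.ℓ fr.hℓ fr.amin fr.aplus fr.m2plus fr.ha fr.creg fr.β fr.hcreg fr.hβ
/-- the big-block modulus of (2.58) for the frame. [cite: Balaban1982Higgs2, Prop. 2.2 p. 570] -/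
abbrev KP1 : ℕ := KP fr.F fr.hℓ₁ fr.hLip d fr.ℓ fr.hℓ fr.amin fr.aplus fr.m2plus fr.ha

/-- EVERY `FrameS` upgrades to a `FrameU`: shrink `δO` to `min δO δ₀`, enlarge `cO` to `max cO (a₊c₀e^{δ₀})` and `SO` to
`max SO K_{d+1}(δO/2)` — choices of constants, no hypothesis on the data. [cite: Balaban1982Higgs2, Lemma 2.4 p. 572] -/
def ofFrameS (fr₀ : FrameS ι d) : FrameU ι d :=
  let δ' : ℝ := min fr₀.δO (dP fr₀.F fr₀.hℓ₁ fr₀.hLip d fr₀.ℓ fr₀.hℓ fr₀.amin fr₀.aplus fr₀.m2plus fr₀.ha fr₀.creg fr₀.β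
    fr₀.hcreg fr₀.hβ)
  { toFrameS :=
    { toFrameR :=
      { toFrame := { fr₀.toFrame with
          δO := δ'
          cO := max fr₀.cO (fr₀.aplus * cP fr₀.F fr₀.hℓ₁ fr₀.hLip d fr₀.ℓ fr₀.hℓ fr₀.amin fr₀.aplus fr₀.m2plus fr₀.ha
            fr₀.creg fr₀.β fr₀.hcreg fr₀.hβ * Real.exp (dP fr₀.F fr₀.hℓ₁ fr₀.hLip d fr₀.ℓ fr₀.hℓ fr₀.amin fr₀.aplus
            fr₀.m2plus fr₀.ha fr₀.creg fr₀.β fr₀.hcreg fr₀.hβ))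
          SO := max fr₀.SO (B4Sect5Proof.latticeConst (d + 1) (δ' / 2))
          cO_nonneg := le_max_of_le_left fr₀.cO_nonneg
          δO_pos := lt_min fr₀.δO_pos
            (P_spec fr₀.F fr₀.hℓ₁ fr₀.hLip d fr₀.ℓ fr₀.hℓ fr₀.amin fr₀.aplus fr₀.m2plus fr₀.ha fr₀.creg fr₀.β fr₀.hcreg
              fr₀.hβ).1
          SO_nonneg := le_max_of_le_left fr₀.SO_nonneg }
        hd := fr₀.hd
        Kθ' := fr₀.Kθ'
        Kθ'_nonneg := fr₀.Kθ'_nonneg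
        hKD := fr₀.hKD }
      creg := fr₀.creg
      β := fr₀.β
      hcreg := fr₀.hcreg
      hβ := fr₀.hβ
      S := fr₀.S
      hcI := fr₀.hcI }
    hδP := min_le_right _ _
    hcP := le_max_right _ _
    hSP := le_max_right _ _ }

end FrameU

/-! ## §6 The instance with its outer region `Ω = B^k(Λ₂′)` and field; the four (2.58) kernel fields PROVED -/

section Instance

variable [Nonempty ι] {d : ℕ}

/-- **ONE INSTANCE OF LEMMA 2.4 ON THE BOX LINEAGE WITH ITS OUTER REGION**: the fields of `B2Lemma24SupG.ModelT` except the
outer kernel `KΩ`, the distances `dΩ` (and `dΩ_nonneg`, `summableΩ`), the inclusion `inc` (and `inc_inj`), the unit field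
`φ` on `□₂` (and `φΩ_inc`) and THE FOUR (2.58) KERNEL FIELDS `kerΩ_far`, `kerΩ_near`, `dkerΩ_far`, `dkerΩ_near` — replaced by
the DATA of the outer region: the corner `o` of `□₂` in the unit lattice, the unit labels `Ω₀c` of `Ω = B^k(Λ₂′) ⊃ □`
(both unions of big blocks), the component field `A^{(k)}` on `Ω`, (2.23)-regular on `Ω`, its coupling below the (2.58)
threshold, and the depth of `B^k(y)` in `□` at least `R₀` (and `R₄`). [cite: Balaban1982Higgs2, (2.55)–(2.56) p. 570,
Prop. 2.2 (2.58) pp. 570–571, the sentence after (2.60) p. 571, Lemma 2.4 and its proof pp. 572–574; Balaban1983RegularityDecay,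
(1.7) p. 572, §2 p. 575] -/
structure ModelU (fr : FrameU ι d) where
  k : ℕ
  hk : 1 ≤ k
  a : ℝ
  m2 : ℝ
  ha1 : fr.amin ≤ a
  ha2 : a ≤ fr.aplus
  hm1 : 0 ≤ m2
  hm2 : m2 ≤ fr.m2plus
  M : Fin (d + 1) → ℕ
  hM : ∀ i, 1 ≤ M i
  hMS : ∀ i, M i ≤ fr.S
  hM3 : ∀ i, 3 ≤ (fr.ℓ + 1) ^ k * M i
  /-- the lower corner of `□₂` in the unit lattice -/
  o : Fin (d + 1) → ℤ
  /-- the unit labels of `Ω = B^k(Λ₂^{(k−1)′})` -/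
  Ω₀c : Finset (Fin (d + 1) → ℤ)
  /-- `□₂ ⊂ Λ₂′` -/
  hbox : ∀ y : ↥(boxDom M), y.1 + o ∈ Ω₀c
  /-- `Ω` is a union of big blocks -/
  hbigΩ : IsBlockUnion fr.KP1 Ω₀c
  /-- `□₂` is a union of big blocks -/
  hbigB : IsBlockUnion fr.KP1 (boxLabels M o)
  e : ℝ
  he : 0 < e
  hle : e ≤ fr.eNC1
  /-- `e(L^kε)` below the threshold of (2.58) -/
  hleP : e ≤ fr.eP1
  hθ1 : thetaS d fr.S fr.creg fr.β e ≤ 1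
  hτ1 : ((d : ℝ) + 1) * thetaS d fr.S fr.creg fr.β e ≤ 1
  /-- the component field `A^{(k)}` on `Ω` -/
  Ac : (Fin (d + 1) → ℤ) → Fin (d + 1) → ℝ
  /-- (2.23)/(1.7) on `Ω = B^k(Λ₂′)` -/
  hreg : ∀ x ∈ fineDom ((fr.ℓ + 1) ^ k) Ω₀c, ∀ μ ν : Fin (d + 1),
    |Ac (x + e1 μ) ν - Ac x ν| ≤ fr.creg * e ^ (fr.β - 1) / ((fr.ℓ + 1) ^ k : ℕ)
  x₀ : ↥(Box d fr.ℓ k M)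
  y : ↥(boxDom M)
  sq1 : Finset ↥(boxDom M)
  y_mem : y ∈ sq1
  /-- `φ` on the unit sites of `Λ₂′` -/
  φΩ : ↥Ω₀c → ι → ℝ
  p : ℝ
  q : ℝ
  tφ : ℝ
  R₁ : ℝ
  R₂ : ℝ
  R₄ : ℝ
  p_nonneg : 0 ≤ p
  q_nonneg : 0 ≤ q
  tφ_nonneg : 0 ≤ tφ
  R₂_nonneg : 0 ≤ R₂
  q_le : q ≤ fr.K₃ * p
  kap : m2 / (B1.aSeq a ((fr.ℓ : ℝ) + 1) k + m2) * tφ ≤ fr.K₁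
  sepG : Real.exp (-(fr.dG * R₁)) * tφ ≤ fr.K₂
  sepD : Real.exp (-(fr.dD * R₁)) * tφ ≤ fr.K₂
  sepO₂ : Real.exp (-(fr.δO / 2 * R₂)) * tφ ≤ fr.K₄
  sepO₄ : Real.exp (-(fr.δO * R₄)) * tφ ≤ fr.K₅
  θ_scale : thetaS d fr.S fr.creg fr.β e * tφ ≤ fr.Kθ
  τ_scale : ((d : ℝ) + 1) * thetaS d fr.S fr.creg fr.β e * tφ ≤ fr.Kτ
  θ'_scale : fr.creg * e ^ fr.β * tφ ≤ fr.Kθ'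
  far1 : ∀ x : ↥(Box d fr.ℓ k M), blkSite d fr.ℓ k M x = y → ∀ x' : ↥(Box d fr.ℓ k M), blkSite d fr.ℓ k M x' ∉ sq1 →
    R₁ ≤ supNorm (x.1 - x'.1) / (((fr.ℓ + 1) ^ k : ℕ) : ℝ)
  /-- the unit sites of `Λ₆′ ⊂ Λ₂′` carrying `φ` in (2.56) -/
  Tout : Finset ↥Ω₀c
  inc_mem : ∀ y' ∈ sq1, boxEmbY M o hbox y' ∈ Tout
  /-- the sites of (2.56) off `□₁` are at label distance `≥ R₂` from `B^k(y)` -/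
  farΩ : ∀ x : ↥(Box d fr.ℓ k M), blkSite d fr.ℓ k M x = y → ∀ y' ∈ Tout, y' ∉ sq1.image (boxEmbY M o hbox) →
    R₂ ≤ supNorm ((blkSite d fr.ℓ k M x).1 + o - y'.1)
  R : ℕ
  hR1 : 1 ≤ R
  deep : ∀ x : ↥(Box d fr.ℓ k M), blkSite d fr.ℓ k M x = y →
    ∀ i, ((R * (fr.ℓ + 1) ^ k : ℕ) : ℤ) ≤ x.1 i ∧ x.1 i + (R * (fr.ℓ + 1) ^ k : ℕ) + 1 ≤ (((fr.ℓ + 1) ^ k * M i : ℕ) : ℤ)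
  /-- the printed restriction of (2.58): `dist(x, □^c) ≥ R₀` on `B^k(y)` -/
  hRP : fr.rP1 ≤ R
  /-- `dist(x, □^c) ≥ R₄` on `B^k(y)` -/
  hR4 : R₄ ≤ R

namespace ModelU

variable {fr : FrameU ι d} (m : ModelU fr)

/-- the running coefficient `a_k`. [cite: Balaban1982Higgs2, (2.56) p. 570; Balaban1982Higgs1, (2.15) p. 609] -/
abbrev ak : ℝ := B1.aSeq m.a ((fr.ℓ : ℝ) + 1) m.k

/-- `0 < a_k`. [cite: Balaban1982Higgs1, (2.15) p. 609] -/
theorem ak_pos : 0 < m.ak := by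
  have hL : (1 : ℝ) < (fr.ℓ : ℝ) + 1 := by
    have : (1 : ℝ) ≤ (fr.ℓ : ℝ) := by exact_mod_cast fr.hℓ
    linarith
  exact B1.aSeq_pos (lt_of_lt_of_le fr.ha m.ha1) hL m.hk

/-- `a_k ≤ a₊`. [cite: Balaban1982Higgs1, (2.15) p. 609] -/
theorem ak_le : m.ak ≤ fr.aplus := by
  have hL : (1 : ℝ) < (fr.ℓ : ℝ) + 1 := by
    have : (1 : ℝ) ≤ (fr.ℓ : ℝ) := by exact_mod_cast fr.hℓ
    linarith
  exact (B1.aSeq_le (lt_of_lt_of_le fr.ha m.ha1) hL m.k m.hk).trans m.ha2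

/-- the field seen from the box: `A^{(k)}(· + L^ko)` (the `Ac` fed to `ModelT`). [cite: Balaban1982Higgs2, (2.67) p. 572] -/
abbrev AcB : (Fin (d + 1) → ℤ) → Fin (d + 1) → ℝ := shiftF fr.ℓ m.k m.o m.Ac

/-- `□₂ + o ⊆ Λ₂′` in labels. [cite: Balaban1982Higgs2, p. 572 «□ ⊂ B^k(Λ₂^{(k−1)′})»] -/
theorem hsub : boxLabels m.M m.o ⊆ m.Ω₀c := fun y hy => by
  have h := m.hbox ⟨y - m.o, sub_mem_boxDom hy⟩
  simpa using h

/-- the embedding of `□` into the fine region `Ω` (`x ↦ x + L^ko`). [cite: Balaban1982Higgs2, p. 572 «□ ⊂ B^k(Λ₂^{(k−1)′})»] -/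
abbrev E (x : ↥(Box d fr.ℓ m.k m.M)) : ↥(fineDom ((fr.ℓ + 1) ^ m.k) m.Ω₀c) := boxEmb fr.ℓ m.k m.M m.o m.hbox x

/-- the inclusion of the unit sites of `□₂` into those of `Λ₂′` (the model's `inc`). [cite: Balaban1982Higgs2, p. 572] -/
abbrev inc (y' : ↥(boxDom m.M)) : ↥m.Ω₀c := boxEmbY m.M m.o m.hbox y'

/-- (2.23)/(1.7) on `□` for the translated field (from `hreg` on `Ω ⊃ □`) — the `hreg` fed to `ModelT`.
[cite: Balaban1982Higgs2, p. 571 «A^{(k)} … satisfies the assumption of Proposition I.2.1»; Balaban1983RegularityDecay, (1.7) p. 572] -/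
theorem hreg_box : ∀ x ∈ Box d fr.ℓ m.k m.M, ∀ μ ν : Fin (d + 1),
    |m.AcB (x + e1 μ) ν - m.AcB x ν| ≤ fr.creg * m.e ^ (fr.β - 1) / ((fr.ℓ + 1) ^ m.k : ℕ) := by
  intro x hx μ ν
  have hmem : (x + fun i => (((fr.ℓ + 1) ^ m.k : ℕ) : ℤ) * m.o i) ∈ fineDom ((fr.ℓ + 1) ^ m.k) m.Ω₀c :=
    (boxEmb fr.ℓ m.k m.M m.o m.hbox ⟨x, hx⟩).2
  have h := m.hreg _ hmem μ ν
  simp only [AcB, shiftF]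
  rwa [add_right_comm]

/-- THE PAIR `□ ⊂ Ω` as an instance of r01's region-pair family (for the `δG_k(□, Ω, A^{(k)})` clauses).
[cite: Balaban1982Higgs2, Prop. 2.2 p. 571 «δG_k(Ω, Ω₀, A)Q_k^*(A)»; Balaban1983RegularityDecay, (1.11) p. 573] -/
abbrev instI : B4ThmRegionPairEta.RegionPairInst d fr.ℓ fr.amin fr.aplus fr.m2plus where
  k := m.k
  hk := m.hk
  Ω₀c := m.Ω₀c
  Ωc := boxLabels m.M m.o
  hsub := m.hsub
  a := m.a
  m2 := m.m2
  ha1 := m.ha1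
  ha2 := m.ha2
  hm1 := m.hm1
  hm2 := m.hm2
  Ac := m.Ac
  e := m.e

/-- THE PAIR `Ω ⊂ Ω` (for the plain clauses of (2.58) on `G_k(Ω, A^{(k)})`). [cite: Balaban1982Higgs2, Prop. 2.2 (2.58) p. 570] -/
abbrev instO : B4ThmRegionPairEta.RegionPairInst d fr.ℓ fr.amin fr.aplus fr.m2plus where
  k := m.k
  hk := m.hk
  Ω₀c := m.Ω₀c
  Ωc := m.Ω₀c
  hsub := Finset.Subset.refl _
  a := m.a
  m2 := m.m2
  ha1 := m.ha1
  ha2 := m.ha2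
  hm1 := m.hm1
  hm2 := m.hm2
  Ac := m.Ac
  e := m.e

/-- the field is regular on `Ω`: `regular` of the pair `□ ⊂ Ω`. [cite: Balaban1983RegularityDecay, (1.7) p. 572] -/
theorem instI_regular : (B4ThmRegionPairEta.regionPairFam fr.F d fr.ℓ fr.amin fr.aplus fr.m2plus fr.creg fr.β
    fr.KP1 m.instI).regular := m.hreg

/-- `regular` of the pair `Ω ⊂ Ω`. [cite: Balaban1983RegularityDecay, (1.7) p. 572] -/
theorem instO_regular : (B4ThmRegionPairEta.regionPairFam fr.F d fr.ℓ fr.amin fr.aplus fr.m2plus fr.creg fr.β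
    fr.KP1 m.instO).regular := m.hreg

/-- `bigBlocks` of the pair `□ ⊂ Ω`. [cite: Balaban1983RegularityDecay, p. 575 «Ω is a sum of … large blocks»] -/
theorem instI_bigBlocks : (B4ThmRegionPairEta.regionPairFam fr.F d fr.ℓ fr.amin fr.aplus fr.m2plus fr.creg fr.β
    fr.KP1 m.instI).bigBlocks := ⟨m.hbigΩ, m.hbigB⟩

/-- `bigBlocks` of the pair `Ω ⊂ Ω`. [cite: Balaban1983RegularityDecay, p. 575 «Ω is a sum of … large blocks»] -/
theorem instO_bigBlocks : (B4ThmRegionPairEta.regionPairFam fr.F d fr.ℓ fr.amin fr.aplus fr.m2plus fr.creg fr.β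
    fr.KP1 m.instO).bigBlocks := ⟨m.hbigΩ, m.hbigΩ⟩

/-- **THE OUTER KERNEL `K_Ω(x, y′) = a_k(G_k(Ω, A^{(k)})Q_k^*(A^{(k)}))(x, y′)`** of (2.56), `x ∈ □`, `y′ ∈ Λ₂′`: the
`(x + L^ko, y′)` block of r01's `G_k(Ω,A)` composed with the carrier's `Q_k(A)ᵀ` — the `KΩ` fed to `ModelT`.
[cite: Balaban1982Higgs2, (2.56) p. 570, (2.58) p. 570] -/
def KΩ (x : ↥(Box d fr.ℓ m.k m.M)) (y' : ↥m.Ω₀c) : Matrix ι ι ℝ :=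
  Matrix.of fun i j => (m.ak • (m.instO.GΩ fr.F
    * (avgQ fr.F (κS fr.ℓ m.k m.e) (hnk fr.ℓ m.k) m.Ω₀c (acBond m.Ω₀c m.Ac))ᵀ)) (m.E x, i) (y', j)

/-- the label distance `|y(x) + o − y′|_∞` between the block of `x` and the site `y′` — the `dΩ` fed to `ModelT`.
[cite: Balaban1982Higgs2, (2.58) p. 570 «dist(b, y)», dictionary] -/
def dL (x : ↥(Box d fr.ℓ m.k m.M)) (y' : ↥m.Ω₀c) : ℝ := supNorm ((blkSite d fr.ℓ m.k m.M x).1 + m.o - y'.1)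

/-- `dΩ ≥ 0` — the field `dΩ_nonneg`. [cite: Balaban1982Higgs2, (2.58) p. 570, dictionary] -/
theorem dL_nonneg (x : ↥(Box d fr.ℓ m.k m.M)) (y' : ↥m.Ω₀c) : 0 ≤ m.dL x y' := supNorm_nonneg _

/-- **`K_Ω` IS r01's `G_k(Ω, A)` OF THE PAIR `□ ⊂ Ω` composed with the carrier's `Q_k(A)ᵀ`, times `a_k`** (the record form of
the definition: `RegionPairInst.G₀` of `instI`; definitional). [cite: Balaban1982Higgs2, (2.56) p. 570; Balaban1983RegularityDecay, (1.6) p. 572] -/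
theorem KΩ_eq (x : ↥(Box d fr.ℓ m.k m.M)) (y' : ↥m.Ω₀c) :
    m.KΩ x y' = Matrix.of fun i j => (m.ak • (m.instI.G₀ fr.F
      * (avgQ fr.F (κS fr.ℓ m.k m.e) (hnk fr.ℓ m.k) m.Ω₀c (acBond m.Ω₀c m.Ac))ᵀ)) (m.E x, i) (y', j) := rfl

/-- `K_Ω(x,y′)v = a_k·(G_k(Ω,A)f_{y′,v})(x + L^ko)` with the source `f_{y′,v} = Q_k^*(A)(vδ_{y′})`.
[cite: Balaban1982Higgs2, (2.56) p. 570, (2.58) p. 570] -/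
theorem KΩ_mulVec (x : ↥(Box d fr.ℓ m.k m.M)) (y' : ↥m.Ω₀c) (v : ι → ℝ) :
    m.KΩ x y' *ᵥ v = m.ak • fld (m.instO.GΩ fr.F *ᵥ B2Prop22RegularRegionPair.lsrc fr.F m.instO y' v) (m.E x) := by
  rw [KΩ, B2Prop22RegularRegionPair.lsrc, ← fld_mul_avgQ_transpose_mulVec_single, ← block_mulVec_eq_fld,
    ← Matrix.smul_mulVec]
  rfl

/-- the `(x, y′+o)` block against the box kernel: `K_Ω(x, y′+o)v − K_□(x, y′)v = −a_k·(δG_k(□,Ω,A)f_{y′+o,v})(x + L^ko)`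
(`δG_k(□,Ω,A) = G_k(□,A) − G_k(Ω,A)`, r01's `deltaV`; the source extends by zero to the same source, p23 g14's `extR_lsrc`).
[cite: Balaban1982Higgs2, Prop. 2.2 p. 571 «δG_k(Ω,Ω₀,A)Q_k^*(A)»; Balaban1983RegularityDecay, (1.11) p. 573] -/
theorem KΩ_sub_kerBox_mulVec (x : ↥(Box d fr.ℓ m.k m.M)) (y' : ↥(boxDom m.M)) (v : ι → ℝ) :
    (m.KΩ x (m.inc y') - kerBox d fr.F (κS fr.ℓ m.k m.e) fr.ℓ m.k m.a m.m2 m.M (embS d fr.ℓ m.k m.M) (ΓS d fr.ℓ m.k m.M)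
        (A0S d m.AcB m.x₀) (AprS d fr.ℓ m.k m.M (A0S d m.AcB m.x₀) m.AcB) x y') *ᵥ v
      = -(m.ak • fld (m.instI.deltaV fr.F (B2Prop22RegularRegionPair.lsrc fr.F m.instI (eY m.M m.o y') v))
          (eB fr.ℓ m.k m.M m.o x)) := by
  rw [Matrix.sub_mulVec, KΩ_mulVec,
    kerBox_mulVec_eq fr.F m.e fr.ℓ m.k m.a m.m2 m.M m.o m.Ac _ (constBond_add_AprS fr.ℓ m.k m.M _ _)]
  rw [← smul_sub, ← smul_neg]
  congr 1
  funext j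
  rw [Pi.neg_apply, B4ThmRegionPairEta.RegionPairInst.fld_deltaV_apply, B2Prop22RegularRegionPair.extR_lsrc]
  simp only [Pi.sub_apply, fld_apply, neg_sub]
  rfl

/-- the derivative kernel of `K_Ω` along a bond `b = (x, x+e_μ) ⊂ □`: `(D^η_{A,μ}K_Ω)(b, y′)v =
a_k·(D^η_{A,μ}G_k(Ω,A)f_{y′,v})(x + L^ko)`. [cite: Balaban1982Higgs2, (2.58) p. 570, (2.66) p. 572; Balaban1983RegularityDecay, (1.3) p. 572] -/
theorem dKer_KΩ_mulVec (μ : Fin (d + 1)) (x : ↥(Box d fr.ℓ m.k m.M)) (h : x.1 + e1 μ ∈ Box d fr.ℓ m.k m.M) (y' : ↥m.Ω₀c)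
    (v : ι → ℝ) :
    dKer d fr.F (κS fr.ℓ m.k m.e) fr.ℓ m.k m.M (fun u w => compField m.AcB u.1 w.1) m.KΩ μ x h y' *ᵥ v
      = m.ak • fld (m.instO.DΩ fr.F μ *ᵥ (m.instO.GΩ fr.F *ᵥ B2Prop22RegularRegionPair.lsrc fr.F m.instO y' v))
          (m.E x) := by
  rw [dKer, Matrix.smul_mulVec, Matrix.sub_mulVec, ← Matrix.mulVec_mulVec, KΩ_mulVec, KΩ_mulVec, Matrix.mulVec_smul,
    ← smul_sub, smul_comm]
  congr 1
  exact (fld_regionDeriv_boxEmb fr.F m.e fr.ℓ m.k m.M m.o m.Ac m.hbox μ _ x h).symm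

/-- the derivative blocks against the box: `(D_μK_Ω)(b, y′+o)v − (D_μK_□)(b, y′)v = −a_k·(D^η_{A,μ}δG_k(□,Ω,A)f_{y′+o,v})(x + L^ko)`
(r01's `fld_DΩ_deltaV_apply` on the bond of `□`). [cite: Balaban1982Higgs2, Prop. 2.2 p. 571 «D^η_AδG_k(Ω,Ω₀,A)Q_k^*(A)»;
Balaban1983RegularityDecay, (1.11) p. 573] -/
theorem dKer_sub_dkerBox_mulVec (μ : Fin (d + 1)) (x : ↥(Box d fr.ℓ m.k m.M)) (h : x.1 + e1 μ ∈ Box d fr.ℓ m.k m.M)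
    (y' : ↥(boxDom m.M)) (v : ι → ℝ) :
    (dKer d fr.F (κS fr.ℓ m.k m.e) fr.ℓ m.k m.M
        (constBond (A0S d m.AcB m.x₀) Subtype.val + AprS d fr.ℓ m.k m.M (A0S d m.AcB m.x₀) m.AcB) m.KΩ μ x h (m.inc y')
      - dkerBox d fr.F (κS fr.ℓ m.k m.e) fr.ℓ m.k m.a m.m2 m.M (embS d fr.ℓ m.k m.M) (ΓS d fr.ℓ m.k m.M)
          (A0S d m.AcB m.x₀) (AprS d fr.ℓ m.k m.M (A0S d m.AcB m.x₀) m.AcB) μ x y') *ᵥ v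
      = -(m.ak • fld (m.instI.DΩ fr.F μ *ᵥ m.instI.deltaV fr.F
          (B2Prop22RegularRegionPair.lsrc fr.F m.instI (eY m.M m.o y') v)) (eB fr.ℓ m.k m.M m.o x)) := by
  rw [Matrix.sub_mulVec, constBond_add_AprS, dKer_KΩ_mulVec,
    dkerBox_mulVec_eq fr.F m.e fr.ℓ m.k m.a m.m2 m.M m.o m.Ac _ (constBond_add_AprS fr.ℓ m.k m.M _ _)]
  rw [← smul_sub, ← smul_neg]
  congr 1
  funext j
  have hx : (eB fr.ℓ m.k m.M m.o x).1 + e1 μ ∈ fineDom ((fr.ℓ + 1) ^ m.instI.k) m.instI.Ωc :=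
    boxEmb_add_e1_mem fr.ℓ m.k m.M m.o (shift_mem_boxLabels m.M m.o) μ x h
  rw [Pi.neg_apply, B4ThmRegionPairEta.RegionPairInst.fld_DΩ_deltaV_apply _ _ μ _ _ hx,
    B2Prop22RegularRegionPair.extR_lsrc]
  simp only [Pi.sub_apply, fld_apply, neg_sub]
  rfl

/-! ### The printed restriction `dist(x, □^c) ≥ R₀` and the distance bookkeeping -/

/-- `dist(x, □^c) ≥ R` on `B^k(y)` (the depth of the block in `□`). [cite: Balaban1982Higgs2, Prop. 2.2 (2.58) p. 570; p. 571 «for b ⊂ Ω, dist(b, Ω^c) ≧ R₀»] -/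
theorem R_le_cdistI (x : ↥(Box d fr.ℓ m.k m.M)) (hx : blkSite d fr.ℓ m.k m.M x = m.y) :
    (m.R : ℝ) ≤ m.instI.cdist (eB fr.ℓ m.k m.M m.o x) :=
  B4ThmTorusPairEta.lat_le_cdist m.instI _ (Infinite.exists_notMem_finset _)
    fun _ hz => deep_supNorm_le fr.ℓ m.k m.M m.o x (m.deep x hx) hz

/-- `dist(x, Ω^c) ≥ R` on `B^k(y)` (`Ω ⊃ □`). [cite: Balaban1982Higgs2, Prop. 2.2 (2.58) p. 570; p. 571 «for b ⊂ Ω, dist(b, Ω^c) ≧ R₀»] -/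
theorem R_le_cdistO (x : ↥(Box d fr.ℓ m.k m.M)) (hx : blkSite d fr.ℓ m.k m.M x = m.y) :
    (m.R : ℝ) ≤ m.instO.cdist (m.E x) :=
  B4ThmTorusPairEta.lat_le_cdist m.instO _ (Infinite.exists_notMem_finset _)
    fun _ hz => deep_supNorm_le fr.ℓ m.k m.M m.o x (m.deep x hx)
      fun hz' => hz (B4RegionCubeCarrier.fineDom_mono (hnk fr.ℓ m.k) m.hsub hz')

/-- **THE DECAY FACTOR OF (2.58) AGAINST THE LABEL DISTANCE** on `Ω`: `e^{−δ₀dist(x,y′)} ≤ e^{δ₀}e^{−δO|y(x)+o−y′|_∞}`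
(`δO ≤ δ₀`). [cite: Balaban1982Higgs2, (2.58) p. 570 «exp(−δ₀ dist(b, y))», dictionary] -/
theorem exp_ldistO_le (x : ↥(Box d fr.ℓ m.k m.M)) (y' : ↥m.Ω₀c) :
    Real.exp (-(fr.dP1 * B2Prop22RegularRegionPair.ldist m.instO (m.E x) y'))
      ≤ Real.exp fr.dP1 * Real.exp (-(fr.δO * m.dL x y')) := by
  have hn0 : (0 : ℝ) < (((fr.ℓ + 1) ^ m.k : ℕ) : ℝ) := by exact_mod_cast (hnk fr.ℓ m.k)
  have hdP := (P_spec fr.F fr.hℓ₁ fr.hLip d fr.ℓ fr.hℓ fr.amin fr.aplus fr.m2plus fr.ha fr.creg fr.β fr.hcreg fr.hβ).1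
  have h1 : m.dL x y' - 1 ≤ B2Prop22RegularRegionPair.ldist m.instO (m.E x) y' := by
    unfold dL B2Prop22RegularRegionPair.ldist
    rw [le_div_iff₀ hn0, mul_comm]
    exact supNorm_label_le (hnk fr.ℓ m.k) (blk_boxEmb fr.ℓ m.k m.M m.o m.hbox x) y'.1
  rw [← Real.exp_add, Real.exp_le_exp]
  have h2 := mul_le_mul_of_nonneg_left h1 hdP.le
  have h3 := mul_le_mul_of_nonneg_right fr.hδP (m.dL_nonneg x y')
  nlinarith

/-- the same on `□` for a label of `□₂`. [cite: Balaban1982Higgs2, (2.58) p. 570, dictionary] -/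
theorem exp_ldistI_le (x : ↥(Box d fr.ℓ m.k m.M)) (y' : ↥(boxDom m.M)) :
    Real.exp (-(fr.dP1 * B2Prop22RegularRegionPair.ldist m.instI (eB fr.ℓ m.k m.M m.o x) (eY m.M m.o y')))
      ≤ Real.exp fr.dP1 * Real.exp (-(fr.δO * m.dL x (m.inc y'))) := by
  have hn0 : (0 : ℝ) < (((fr.ℓ + 1) ^ m.k : ℕ) : ℝ) := by exact_mod_cast (hnk fr.ℓ m.k)
  have hdP := (P_spec fr.F fr.hℓ₁ fr.hLip d fr.ℓ fr.hℓ fr.amin fr.aplus fr.m2plus fr.ha fr.creg fr.β fr.hcreg fr.hβ).1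
  have h1 : m.dL x (m.inc y') - 1
      ≤ B2Prop22RegularRegionPair.ldist m.instI (eB fr.ℓ m.k m.M m.o x) (eY m.M m.o y') := by
    unfold dL B2Prop22RegularRegionPair.ldist
    rw [le_div_iff₀ hn0, mul_comm]
    exact supNorm_label_le (hnk fr.ℓ m.k) (blk_boxEmb fr.ℓ m.k m.M m.o (shift_mem_boxLabels m.M m.o) x) (y'.1 + m.o)
  rw [← Real.exp_add, Real.exp_le_exp]
  have h2 := mul_le_mul_of_nonneg_left h1 hdP.le
  have h3 := mul_le_mul_of_nonneg_right fr.hδP (m.dL_nonneg x (m.inc y'))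
  nlinarith

/-- the `δG` factor: `e^{−δ₀(dist(x,□^c) + dist(y′,□^c))} ≤ e^{−δO R₄}` on `B^k(y)` (`dist(x, □^c) ≥ R ≥ R₄`, `δO ≤ δ₀`).
[cite: Balaban1982Higgs2, Prop. 2.2 p. 571 «with the additional factor exp(−δ₀(dist(b,Ω^c) + dist(y,Ω^c)))»] -/
theorem exp_cdist_le (x : ↥(Box d fr.ℓ m.k m.M)) (hx : blkSite d fr.ℓ m.k m.M x = m.y) (y' : ↥(boxDom m.M)) :
    Real.exp (-(fr.dP1 * (m.instI.cdist (eB fr.ℓ m.k m.M m.o x)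
        + m.instI.cdist (B2Prop22RegularRegionPair.lbase m.instI (eY m.M m.o y')))))
      ≤ Real.exp (-(fr.δO * m.R₄)) := by
  have hdP := (P_spec fr.F fr.hℓ₁ fr.hLip d fr.ℓ fr.hℓ fr.amin fr.aplus fr.m2plus fr.ha fr.creg fr.β fr.hcreg fr.hβ).1
  rw [Real.exp_le_exp]
  have h1 := m.R_le_cdistI x hx
  have h2 := m.instI.cdist_nonneg (B2Prop22RegularRegionPair.lbase m.instI (eY m.M m.o y'))
  have h3 : fr.δO * m.R₄ ≤ fr.δO * m.R := mul_le_mul_of_nonneg_left m.hR4 fr.δO_pos.le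
  have h4 : fr.δO * (m.R : ℝ) ≤ fr.dP1 * m.R := mul_le_mul_of_nonneg_right fr.hδP (Nat.cast_nonneg _)
  have h5 := mul_le_mul_of_nonneg_left h1 hdP.le
  nlinarith

/-! ### The four (2.58) kernel fields as theorems -/

/-- **(2.58) FOR `G_k(Ω,A^{(k)})Q_k^*(A^{(k)})` — THE FIELD `kerΩ_far` PROVED**: for `x ∈ B^k(y)` and every `y′ ∈ Λ₂′`,
`|K_Ω(x,y′)v| ≤ cO·e^{−δO|y(x)+o−y′|_∞}|v|`. [cite: Balaban1982Higgs2, Prop. 2.2 (2.58) p. 570 «The identical inequality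
holds for G_k(Ω, A)Q_k^*(A)», (2.67) p. 572] -/
theorem kerΩ_far (x : ↥(Box d fr.ℓ m.k m.M)) (hx : blkSite d fr.ℓ m.k m.M x = m.y) (y' : ↥m.Ω₀c) (v : ι → ℝ) :
    siteNorm (m.KΩ x y' *ᵥ v) ≤ fr.cO * Real.exp (-(fr.δO * m.dL x y')) * siteNorm v := by
  obtain ⟨hdP, hcP, -, -, H⟩ := P_spec fr.F fr.hℓ₁ fr.hLip d fr.ℓ fr.hℓ fr.amin fr.aplus fr.m2plus fr.ha fr.creg fr.β
    fr.hcreg fr.hβ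
  have h1 := (H m.instO m.instO_regular m.instO_bigBlocks m.he m.hleP (m.E x) y' v (m.hRP.trans (m.R_le_cdistO x hx))).1
  have hv := siteNorm_nonneg v
  have he := m.exp_ldistO_le x y'
  rw [KΩ_mulVec, siteNorm_smul, abs_of_pos m.ak_pos]
  calc m.ak * siteNorm (fld (m.instO.GΩ fr.F *ᵥ B2Prop22RegularRegionPair.lsrc fr.F m.instO y' v) (m.E x))
      ≤ fr.aplus * (fr.cP1 * (Real.exp fr.dP1 * Real.exp (-(fr.δO * m.dL x y'))) * siteNorm v) := by
        refine mul_le_mul m.ak_le (h1.trans ?_) (siteNorm_nonneg _) fr.aplus_pos.le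
        exact mul_le_mul_of_nonneg_right (mul_le_mul_of_nonneg_left he hcP.le) hv
    _ = (fr.aplus * fr.cP1 * Real.exp fr.dP1) * (Real.exp (-(fr.δO * m.dL x y')) * siteNorm v) := by ring
    _ ≤ fr.cO * (Real.exp (-(fr.δO * m.dL x y')) * siteNorm v) := mul_le_mul_of_nonneg_right fr.hcP (by positivity)
    _ = fr.cO * Real.exp (-(fr.δO * m.dL x y')) * siteNorm v := by ring

/-- **(2.58) FOR `δG_k(□,Ω,A^{(k)})Q_k^*(A^{(k)})` — THE FIELD `kerΩ_near` PROVED**: for `x ∈ B^k(y)` and `y′ ∈ □₂`,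
`|(K_Ω(x,y′+o) − K_□(x,y′))v| ≤ cO·e^{−δO R₄}·e^{−δO|y(x)−y′|_∞}|v|`. [cite: Balaban1982Higgs2, Prop. 2.2 p. 571 «and for …
δG_k(Ω, Ω₀, A)Q_k^*(A) with the additional factor», (2.67) p. 572] -/
theorem kerΩ_near (x : ↥(Box d fr.ℓ m.k m.M)) (hx : blkSite d fr.ℓ m.k m.M x = m.y) (y' : ↥(boxDom m.M)) (v : ι → ℝ) :
    siteNorm ((m.KΩ x (m.inc y') - kerBox d fr.F (κS fr.ℓ m.k m.e) fr.ℓ m.k m.a m.m2 m.M (embS d fr.ℓ m.k m.M)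
        (ΓS d fr.ℓ m.k m.M) (A0S d m.AcB m.x₀) (AprS d fr.ℓ m.k m.M (A0S d m.AcB m.x₀) m.AcB) x y') *ᵥ v)
      ≤ fr.cO * Real.exp (-(fr.δO * m.R₄)) * Real.exp (-(fr.δO * m.dL x (m.inc y'))) * siteNorm v := by
  obtain ⟨hdP, hcP, -, -, H⟩ := P_spec fr.F fr.hℓ₁ fr.hLip d fr.ℓ fr.hℓ fr.amin fr.aplus fr.m2plus fr.ha fr.creg fr.β
    fr.hcreg fr.hβ
  have h3 := (H m.instI m.instI_regular m.instI_bigBlocks m.he m.hleP (eB fr.ℓ m.k m.M m.o x) (eY m.M m.o y') v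
    (m.hRP.trans (m.R_le_cdistI x hx))).2.2.1
  have hv := siteNorm_nonneg v
  have he := m.exp_ldistI_le x y'
  have hc := m.exp_cdist_le x hx y'
  rw [KΩ_sub_kerBox_mulVec, B4Lemma22PertVSup.siteNorm_neg, siteNorm_smul, abs_of_pos m.ak_pos]
  calc m.ak * siteNorm (fld (m.instI.deltaV fr.F (B2Prop22RegularRegionPair.lsrc fr.F m.instI (eY m.M m.o y') v))
          (eB fr.ℓ m.k m.M m.o x))
      ≤ fr.aplus * (fr.cP1 * (Real.exp fr.dP1 * Real.exp (-(fr.δO * m.dL x (m.inc y'))))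
          * Real.exp (-(fr.δO * m.R₄)) * siteNorm v) := by
        refine mul_le_mul m.ak_le (h3.trans ?_) (siteNorm_nonneg _) fr.aplus_pos.le
        refine mul_le_mul (mul_le_mul (mul_le_mul_of_nonneg_left he hcP.le) hc (Real.exp_pos _).le
          (by positivity)) le_rfl hv (by positivity)
    _ = (fr.aplus * fr.cP1 * Real.exp fr.dP1)
          * (Real.exp (-(fr.δO * m.R₄)) * Real.exp (-(fr.δO * m.dL x (m.inc y'))) * siteNorm v) := by ring
    _ ≤ fr.cO * (Real.exp (-(fr.δO * m.R₄)) * Real.exp (-(fr.δO * m.dL x (m.inc y'))) * siteNorm v) :=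
        mul_le_mul_of_nonneg_right fr.hcP (by positivity)
    _ = fr.cO * Real.exp (-(fr.δO * m.R₄)) * Real.exp (-(fr.δO * m.dL x (m.inc y'))) * siteNorm v := by ring

/-- **(2.58) FOR `D^η_AG_k(Ω,A^{(k)})Q_k^*(A^{(k)})` — THE FIELD `dkerΩ_far` PROVED**: on every bond `(x, x+e_μ) ⊂ □` with
`x ∈ B^k(y)`, `|(D^η_{A,μ}K_Ω)(b,y′)v| ≤ cO·e^{−δO|y(x)+o−y′|_∞}|v|`. [cite: Balaban1982Higgs2, Prop. 2.2 (2.58) p. 570, (2.67)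
p. 572 «the same equality for the covariant derivative»] -/
theorem dkerΩ_far (μ : Fin (d + 1)) (x : ↥(Box d fr.ℓ m.k m.M)) (hx : blkSite d fr.ℓ m.k m.M x = m.y)
    (h : x.1 + e1 μ ∈ Box d fr.ℓ m.k m.M) (y' : ↥m.Ω₀c) (v : ι → ℝ) :
    siteNorm (dKer d fr.F (κS fr.ℓ m.k m.e) fr.ℓ m.k m.M
        (constBond (A0S d m.AcB m.x₀) Subtype.val + AprS d fr.ℓ m.k m.M (A0S d m.AcB m.x₀) m.AcB) m.KΩ μ x h y' *ᵥ v)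
      ≤ fr.cO * Real.exp (-(fr.δO * m.dL x y')) * siteNorm v := by
  obtain ⟨hdP, hcP, -, -, H⟩ := P_spec fr.F fr.hℓ₁ fr.hLip d fr.ℓ fr.hℓ fr.amin fr.aplus fr.m2plus fr.ha fr.creg fr.β
    fr.hcreg fr.hβ
  have hmem : (m.E x).1 + e1 μ ∈ fineDom ((fr.ℓ + 1) ^ m.instO.k) m.instO.Ωc := boxEmb_add_e1_mem fr.ℓ m.k m.M m.o m.hbox μ x h
  have h2 := (H m.instO m.instO_regular m.instO_bigBlocks m.he m.hleP (m.E x) y' v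
    (m.hRP.trans (m.R_le_cdistO x hx))).2.1 μ hmem
  have hv := siteNorm_nonneg v
  have he := m.exp_ldistO_le x y'
  rw [constBond_add_AprS, dKer_KΩ_mulVec, siteNorm_smul, abs_of_pos m.ak_pos]
  calc m.ak * siteNorm (fld (m.instO.DΩ fr.F μ *ᵥ (m.instO.GΩ fr.F *ᵥ B2Prop22RegularRegionPair.lsrc fr.F m.instO y' v))
          (m.E x))
      ≤ fr.aplus * (fr.cP1 * (Real.exp fr.dP1 * Real.exp (-(fr.δO * m.dL x y'))) * siteNorm v) := by
        refine mul_le_mul m.ak_le (h2.trans ?_) (siteNorm_nonneg _) fr.aplus_pos.le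
        exact mul_le_mul_of_nonneg_right (mul_le_mul_of_nonneg_left he hcP.le) hv
    _ = (fr.aplus * fr.cP1 * Real.exp fr.dP1) * (Real.exp (-(fr.δO * m.dL x y')) * siteNorm v) := by ring
    _ ≤ fr.cO * (Real.exp (-(fr.δO * m.dL x y')) * siteNorm v) := mul_le_mul_of_nonneg_right fr.hcP (by positivity)
    _ = fr.cO * Real.exp (-(fr.δO * m.dL x y')) * siteNorm v := by ring

/-- **(2.58) FOR `D^η_AδG_k(□,Ω,A^{(k)})Q_k^*(A^{(k)})` — THE FIELD `dkerΩ_near` PROVED**.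
[cite: Balaban1982Higgs2, Prop. 2.2 p. 571 «D^η_AδG_k(Ω, Ω₀, A)Q_k^*(A) … with the additional factor», (2.67) p. 572] -/
theorem dkerΩ_near (μ : Fin (d + 1)) (x : ↥(Box d fr.ℓ m.k m.M)) (hx : blkSite d fr.ℓ m.k m.M x = m.y)
    (h : x.1 + e1 μ ∈ Box d fr.ℓ m.k m.M) (y' : ↥(boxDom m.M)) (v : ι → ℝ) :
    siteNorm ((dKer d fr.F (κS fr.ℓ m.k m.e) fr.ℓ m.k m.M
        (constBond (A0S d m.AcB m.x₀) Subtype.val + AprS d fr.ℓ m.k m.M (A0S d m.AcB m.x₀) m.AcB) m.KΩ μ x h (m.inc y')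
      - dkerBox d fr.F (κS fr.ℓ m.k m.e) fr.ℓ m.k m.a m.m2 m.M (embS d fr.ℓ m.k m.M) (ΓS d fr.ℓ m.k m.M)
          (A0S d m.AcB m.x₀) (AprS d fr.ℓ m.k m.M (A0S d m.AcB m.x₀) m.AcB) μ x y') *ᵥ v)
      ≤ fr.cO * Real.exp (-(fr.δO * m.R₄)) * Real.exp (-(fr.δO * m.dL x (m.inc y'))) * siteNorm v := by
  obtain ⟨hdP, hcP, -, -, H⟩ := P_spec fr.F fr.hℓ₁ fr.hLip d fr.ℓ fr.hℓ fr.amin fr.aplus fr.m2plus fr.ha fr.creg fr.β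
    fr.hcreg fr.hβ
  have hmem : (eB fr.ℓ m.k m.M m.o x).1 + e1 μ ∈ fineDom ((fr.ℓ + 1) ^ m.instI.k) m.instI.Ωc :=
    boxEmb_add_e1_mem fr.ℓ m.k m.M m.o (shift_mem_boxLabels m.M m.o) μ x h
  have h4 := (H m.instI m.instI_regular m.instI_bigBlocks m.he m.hleP (eB fr.ℓ m.k m.M m.o x) (eY m.M m.o y') v
    (m.hRP.trans (m.R_le_cdistI x hx))).2.2.2 μ hmem
  have hv := siteNorm_nonneg v
  have he := m.exp_ldistI_le x y'
  have hc := m.exp_cdist_le x hx y'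
  rw [dKer_sub_dkerBox_mulVec, B4Lemma22PertVSup.siteNorm_neg, siteNorm_smul, abs_of_pos m.ak_pos]
  calc m.ak * siteNorm (fld (m.instI.DΩ fr.F μ *ᵥ m.instI.deltaV fr.F
          (B2Prop22RegularRegionPair.lsrc fr.F m.instI (eY m.M m.o y') v)) (eB fr.ℓ m.k m.M m.o x))
      ≤ fr.aplus * (fr.cP1 * (Real.exp fr.dP1 * Real.exp (-(fr.δO * m.dL x (m.inc y'))))
          * Real.exp (-(fr.δO * m.R₄)) * siteNorm v) := by
        refine mul_le_mul m.ak_le (h4.trans ?_) (siteNorm_nonneg _) fr.aplus_pos.le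
        refine mul_le_mul (mul_le_mul (mul_le_mul_of_nonneg_left he hcP.le) hc (Real.exp_pos _).le
          (by positivity)) le_rfl hv (by positivity)
    _ = (fr.aplus * fr.cP1 * Real.exp fr.dP1)
          * (Real.exp (-(fr.δO * m.R₄)) * Real.exp (-(fr.δO * m.dL x (m.inc y'))) * siteNorm v) := by ring
    _ ≤ fr.cO * (Real.exp (-(fr.δO * m.R₄)) * Real.exp (-(fr.δO * m.dL x (m.inc y'))) * siteNorm v) :=
        mul_le_mul_of_nonneg_right fr.hcP (by positivity)
    _ = fr.cO * Real.exp (-(fr.δO * m.R₄)) * Real.exp (-(fr.δO * m.dL x (m.inc y'))) * siteNorm v := by ring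

/-! ### The lattice sum over the outer sites -/

/-- **`Σ_{y′ ∈ Tout} e^{−(δO/2)|y(x)+o−y′|_∞} ≤ SO`** — THE FIELD `summableΩ` PROVED (b05's uniform lattice sums on `ℤ^{d+1}`,
`B4Sect5Proof.latticeSum_le`). [cite: Balaban1983RegularityDecay, (2.39) p. 582; p. 583 «where the constant c₁ is built of c₀, c₁₅, Σ_{x∈Z^d} e^{−δ₀|x|}, …»] -/
theorem summableΩ (x : ↥(Box d fr.ℓ m.k m.M)) : ∑ y' ∈ m.Tout, Real.exp (-(fr.δO / 2 * m.dL x y')) ≤ fr.SO := by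
  have hδ : 0 < fr.δO / 2 := half_pos fr.δO_pos
  refine le_trans ?_ fr.hSP
  set b : Fin (d + 1) → ℤ := (blkSite d fr.ℓ m.k m.M x).1 + m.o with hb
  have hpt : ∀ y' : ↥m.Ω₀c, Real.exp (-(fr.δO / 2 * m.dL x y')) ≤ Real.exp (-(fr.δO / 2 * dist b y'.1)) := by
    intro y'
    rw [Real.exp_le_exp]
    have : dist b y'.1 ≤ m.dL x y' := by
      unfold dL
      rw [dist_pi_le_iff (supNorm_nonneg _)]
      intro i
      rw [Int.dist_eq]
      have h := abs_le_supNorm (b - y'.1) i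
      rw [Pi.sub_apply] at h
      push_cast at h
      exact h
    nlinarith
  calc ∑ y' ∈ m.Tout, Real.exp (-(fr.δO / 2 * m.dL x y'))
      ≤ ∑ y' ∈ m.Tout, Real.exp (-(fr.δO / 2 * dist b y'.1)) := Finset.sum_le_sum fun y' _ => hpt y'
    _ = ∑ z ∈ m.Tout.map ⟨Subtype.val, Subtype.val_injective⟩, Real.exp (-(fr.δO / 2 * dist b z)) := by
        rw [Finset.sum_map]; rfl
    _ ≤ B4Sect5Proof.latticeConst (d + 1) (fr.δO / 2) := B4Sect5Proof.latticeSum_le (d + 1) hδ _ b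

/-! ## §7 The `ModelT` instance with the four kernel fields filled by the theorems; row B2.Lem2.4 for the family -/

/-- **THE `ModelT` INSTANCE**: `KΩ :=` the region kernel, `dΩ :=` the label distance, `inc :=` the label embedding,
`φ := φ ∘ inc`, `Ac :=` the translated component field; `kerΩ_far`, `kerΩ_near`, `dkerΩ_far`, `dkerΩ_near`, `summableΩ`,
`dΩ_nonneg`, `inc_inj`, `φΩ_inc` := the theorems. [cite: Balaban1982Higgs2, Lemma 2.4 p. 572, (2.56) p. 570, (2.58) pp. 570–571] -/
def toModelT : ModelT fr.toFrameS ↥m.Ω₀c where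
  k := m.k
  hk := m.hk
  a := m.a
  m2 := m.m2
  ha1 := m.ha1
  ha2 := m.ha2
  hm1 := m.hm1
  hm2 := m.hm2
  M := m.M
  hM := m.hM
  hMS := m.hMS
  hM3 := m.hM3
  e := m.e
  he := m.he
  hle := m.hle
  hθ1 := m.hθ1
  hτ1 := m.hτ1
  Ac := m.AcB
  hreg := m.hreg_box
  x₀ := m.x₀
  y := m.y
  sq1 := m.sq1
  y_mem := m.y_mem
  φ := fun y' => m.φΩ (m.inc y')
  p := m.p
  q := m.q
  tφ := m.tφ
  R₁ := m.R₁
  R₂ := m.R₂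
  R₄ := m.R₄
  p_nonneg := m.p_nonneg
  q_nonneg := m.q_nonneg
  tφ_nonneg := m.tφ_nonneg
  R₂_nonneg := m.R₂_nonneg
  q_le := m.q_le
  kap := m.kap
  sepG := m.sepG
  sepD := m.sepD
  sepO₂ := m.sepO₂
  sepO₄ := m.sepO₄
  θ_scale := m.θ_scale
  τ_scale := m.τ_scale
  θ'_scale := m.θ'_scale
  far1 := m.far1
  Tout := m.Tout
  inc := m.inc
  inc_inj := boxEmbY_injective m.M m.o m.hbox
  inc_mem := m.inc_mem
  KΩ := m.KΩ
  φΩ := m.φΩ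
  φΩ_inc := fun _ _ => rfl
  dΩ := m.dL
  dΩ_nonneg := m.dL_nonneg
  summableΩ := m.summableΩ
  kerΩ_far := fun x hx y' _ _ v => m.kerΩ_far x hx y' v
  farΩ := m.farΩ
  kerΩ_near := fun x hx y' _ v => m.kerΩ_near x hx y' v
  dkerΩ_far := fun μ x hx h y' _ _ v => m.dkerΩ_far μ x hx h y' v
  dkerΩ_near := fun μ x hx h y' _ v => m.dkerΩ_near μ x hx h y' v
  R := m.R
  hR1 := m.hR1
  deep := m.deep

/-- the built instance has the instance's scale `p`. [cite: Balaban1982Higgs2, Lemma 2.4 p. 572] -/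
@[simp] theorem toModelT_p : m.toModelT.p = m.p := rfl

end ModelU

/-- the row's carrier filled by an instance: that of the built `ModelT` (restrictions (2.55), the three suprema of
(2.65)/(2.66) — now of the GENUINE outer field `φ^{(k)} = a_kG_k(Ω,A^{(k)})Q_k^*(A^{(k)})φ` of (2.56) —, the scale `p(L^kε)`).
[cite: Balaban1982Higgs2, Lemma 2.4 (2.65)–(2.66) p. 572, (2.56) p. 570] -/
def famOfU (fr : FrameU ι d) (m : ModelU fr) : B2.L24Setting := famOfT fr.toFrameS ↥m.Ω₀c m.toModelT

/-- **ROW B2.Lem2.4 — LEMMA 2.4 (2.65)–(2.66), THE DECL OF RECORD `B2.Lemma24Printed`, FOR THE FAMILY WHOSE FOUR (2.58)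
KERNEL INPUTS ARE THEOREMS**: one constant `C` per frame (uniform over the outer regions `Ω`, i.e. over the volume), and
`dev265a, dev265b, dev266 ≤ C·p(L^kε)` for every instance obeying (2.55) — `B2Lemma24Proof.lemma24_bounds` (whose constant is
uniform in the outer-site type) along `toModelT ∘ toModelS ∘ toModelR ∘ toModel`.  `C` is obtained from `lemma24_bounds
fr.toFrame` BEFORE the instance `m` is introduced: it is a function of the frame `fr.toFrame` only (no `S`, no `Ω₀c`/`Tout`,
no `k`, `M`, `A`, `φ`, `e`; HONEST SCOPE (d)). [cite: Balaban1982Higgs2, Lemma 2.4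
(2.65)–(2.66) p. 572; proof (2.67)–(2.77) pp. 572–574; Prop. 2.2 (2.58) pp. 570–571] [cite: Balaban1983RegularityDecay,
Theorem p. 573, (1.1)–(1.6) p. 572] -/
theorem lemma24Printed_modelU (fr : FrameU ι d) : B2.Lemma24Printed (famOfU fr) := by
  obtain ⟨C, -, h⟩ := lemma24_bounds fr.toFrame
  refine ⟨C, fun m hR => ?_⟩
  have hR' : m.toModelT.toModelS.toModelR.Restr := hR
  obtain ⟨h1, h2, h3⟩ := h _ (m.toModelT.toModelS.toModelR.toModel hR') (m.toModelT.toModelS.toModelR.toModel_restr hR')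
  obtain ⟨e1, e2, e3⟩ := m.toModelT.toModelS.toModelR.toModel_dev hR'
  refine ⟨?_, ?_, ?_⟩
  · show m.toModelT.toModelS.toModelR.dev265a ≤ C * m.p
    rw [← e1]; exact h1
  · show m.toModelT.toModelS.toModelR.dev265b ≤ C * m.p
    rw [← e2]; exact h2
  · show m.toModelT.toModelS.toModelR.dev266 ≤ C * m.p
    rw [← e3]; exact h3

end Instance

end

end Literature.MathematicalPhysics.QuantumFieldTheory.Balaban1983to89.B2Lemma24KerOmega
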